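import Literature.Topology.FourManifolds.BordismMerging
import Literature.Topology.FourManifolds.BCSBoundaryOrientation
import Literature.Topology.FourManifolds.BCSConstruction
import Literature.Topology.FourManifolds.HomotopySpheresBPProofs
import Literature.Topology.FourManifolds.NullCobordismOrientedBy
import Literature.AlgebraicTopology.SingularHomology.BoundaryTransfer
import Literature.AlgebraicTopology.SingularHomology.LocalDegreeLinearization
import HarnessLib

/-!
# Oriented merging: `(A ⊔ B, α ⊔ β)` is oriented-bordant to `A # B`; Kirby's Cor. IX.2 reduced to
# connected manifolds

Topic `Literature/Topology/FourManifolds` (fact seat of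
`Literature.Topology.FourManifolds.isOrientedBordant_of_isEmpty_of_signature_eq_zero`, Kirby
1989, Cor. IX.2).  Sequel of `BordismFourComponents` (reduction of Cor. IX.2 to CONNECTED `M`
modulo the merging step `hmerge`) and `BordismMerging` (the unoriented merging bordism, the
boundary connected sum `(A × I) ♮ (B × I)` of the cylinders).  This file ORIENTS the merging
bordism and thereby proves `hmerge`, so that Kirby's Cor. IX.2 in every universe now follows from
its case of connected `M : Type` alone (`isOrientedBordant_of_isEmpty_of_signature_eq_zero_of_connected'`).

R. C. Kirby, *The topology of 4-manifolds*, LNM 1374 (1989), Ch. VIII (Thm 1 is stated for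
connected `M⁴`; classes of `Ω₄^SO` have connected representatives) and Cor. IX.2; M. Kervaire,
J. Milnor, *Groups of homotopy spheres I*, Ann. of Math. 77 (1963), §2, Lemma 2.2 and its
Addendum: "`bW = bW₁ # bW₂`" **as oriented manifolds** — the orientation of the boundary
connected sum is compatible with both pieces provided the two discs have opposite handedness.

## The argument

* **Oriented cylinders.**  For closed connected oriented `(A, α)` the cylinder `A × I` is a
  null-cobordism of the double `A ⊔ A` (`cylinderNull`) and the class `w` with
  `∂w = (i₀)_*[A]_α − (i₁)_*[A]_α` (exactness, as in `isOrientedBordant_refl`) is a RELATIVE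
  FUNDAMENTAL CLASS because the cylinder is connected (`Cobordism.isRelFundamentalClass_of_δ_eq`,
  from the tree's local criterion `isRelFundamentalClass_of_isGenerator_toLocal_δ_of_isManifold`);
  its boundary orientation on the bottom copy is `α` (`exists_isRelFundamentalClass_cylinderNull`).
* **Gluing.**  The boundary connected sum of the two cylinders at discs of the top copies
  (`NullCobordism.bcsSetupOf`, the tree's `BCSSetup`) carries a glued relative fundamental class
  `w_U` matching `w_S` exactly and `w_T` up to a sign `ε = ±1`
  (`BCSGluing.exists_isRelFundamentalClass`, Kervaire–Milnor §2).
* **The sign, read on the half-ball.**  Pulling the interior orientations back along the collar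
  half-discs to the open unit half-ball `V ⊂ ℝⁿ⁺²` (`halfBallOrientation`), the gluing identity
  `ι₂ (k_T ((1-t)u)) = ι₁ (k_S (t u))` gives `b_S = ε · (b_T)` transported along the
  Kervaire–Milnor inversion (`BCSSetup.halfBallOrientation_localClass_eq_smul`).  Replacing the
  disc `i` of `B` by `i ∘ r` (`r` a reflection) replaces `b_T` by its transport along a linear
  reflection `R` of `V` (`halfDisc_comp_tailReflect`), which commutes with the inversion and
  REVERSES every orientation of the connected half-ball (`comap_halfBallReflect_localClass`, from
  the tree's local degree of affine maps `map_affine_localClass`, `det R = −1`); hence the sign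
  flips (`units_eq_neg_of_halfBall`) and for one of the two discs `ε = 1`.  (No shortcut exists:
  with a fixed disc the untouched copy of `B` carries `εβ` whatever one does — a parity
  obstruction.)
* **Boundary orientations.**  The boundary orientation `∂w_U` at the points attached to a linked
  piece is `u` times the transported boundary orientation of the piece
  (`Piece.boundaryOrientation_localClass_eq_smul_linkOrientation`, the purely homological form of
  the tree's `boundaryOrientation_localClass_eq_smul`, via the locality of the boundary class
  `toLocal_δ_eq_of_two_embeddings_manifold`); with `u = 1` on both links the orientation of
  `(A ⊔ A) # (B ⊔ B) ≅ (A ⊔ B) ⊔ (A # B)` induced by `w_U` restricts to `α`, `β` on the untouched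
  bottom copies (orientations of connected manifolds agreeing at a point are equal), and a
  null-cobordism with a relative fundamental class is an oriented null-bordism of its boundary
  (`NullCobordism.isOrientedBordant_boundaryOrientation_comap`), which Thom's dictionary reads as
  `(α ⊔ β) ∼ −Θ_C` (`IsOrientedBordant.of_sum_of_isEmpty`).

## Main statements

* `exists_isOrientedBordant_sum_connectedSpace` — **oriented merging** in dimension `n + 1 ≥ 2`,
  manifolds in `Type`;
* `isOrientedBordant_of_isEmpty_of_signature_eq_zero_of_connected'` — **Kirby's Cor. IX.2 in
  every universe follows from its case of connected closed oriented `M : Type`** (the XL core: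
  Kirby VIII Thm 1(A) with IX Thm 1).

Also: `HomologicalOrientation.pullback` along open embeddings (generalising the tree's
`restrictOpens`), `NullCobordism.interiorOrientation`, the half-ball toolkit, linear reflections
of `ℝᵏ⁺¹`/`ℍⁿ⁺²` with determinant `−1`.  Definitions are explicit constructions; no named facts.

## References

* R. C. Kirby, *The topology of 4-manifolds*, LNM 1374, Springer (1989), Ch. VIII, Cor. IX.2.
  [Kirby1989]
* M. A. Kervaire, J. W. Milnor, *Groups of homotopy spheres: I*, Ann. of Math. (2) 77 (1963),
  §2, Lemma 2.2 and Addendum, pp. 507–508. [KervaireMilnorAnnals1963]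
* J. Milnor, J. Stasheff, *Characteristic classes*, Ann. of Math. Studies 76 (1974), §17,
  Lemma 17.1. [MilnorStasheffAMS76]
* A. Hatcher, *Algebraic Topology*, CUP 2002, §2.2 Ex. 7, §3.3 pp. 231–236, p. 253. [HatcherAT2002]
* E. H. Spanier, *Algebraic Topology*, Springer 1981, Ch. 6 §3 Cor. 10. [Spanier1981]
* A. Juhász, *Differential and Low-Dimensional Topology*, CUP 2023, Def. 1.47. [Juhasz2023]
* M. W. Hirsch, *Differential Topology*, Springer 1976, §4.6. [Hirsch1976]
-/

open scoped Manifold ContDiff Topology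
open Set Function TopologicalSpace Topology CategoryTheory
open Literature.AlgebraicTopology.SingularHomology
open Literature.AlgebraicTopology.SingularHomology.SingularSimplex (sumInl sumInr)

noncomputable section

namespace Literature.Topology.FourManifolds

universe u

/-! ### O1. A homological bordism datum over a connected total space is a relative fundamental class -/

section RelFundamental

variable {n : ℕ} {M N : Type u} [TopologicalSpace M] [ChartedSpace (EuclideanSpace ℝ (Fin (n + 1))) M]
  [TopologicalSpace N] [ChartedSpace (EuclideanSpace ℝ (Fin (n + 1))) N]

/-- **A homological bordism datum over a connected total space is a relative fundamental class.**
If `w ∈ Hₙ₊₂(W, ∂W; ℤ)` satisfies `∂w = (inl)_*[M]_μ − (inr)_*[N]_ν` for `ℤ`-orientations of the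
compact ends of a smooth cobordism `W` with `W` CONNECTED and `M` nonempty, then `w` is a
relative fundamental class of `(W, ∂W)`: `∂w` restricts to generators at every boundary point
(`BoundarySplitting.isGenerator_toLocal_of_eq_sub`), every point of `W` lies in the component of
a boundary point, and the local criterion
`isRelFundamentalClass_of_isGenerator_toLocal_δ_of_isManifold` applies (Spanier 1981, Ch. 6 §3,
converse of Cor. 10, as used implicitly in the identification of homological and geometric
oriented bordism, Milnor–Stasheff 1974, §17 p. 200). [cite: Spanier1981, Ch. 6 Sec. 3 Cor. 10] -/
theorem Cobordism.isRelFundamentalClass_of_δ_eq [CompactSpace M] [T2Space M] [CompactSpace N] [T2Space N]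
    [Nonempty M] (c : Cobordism (n + 1) M N) [ConnectedSpace c.W]
    (μ : HomologicalOrientation ℤ M (n + 1)) (ν : HomologicalOrientation ℤ N (n + 1))
    {w : relativeSingularHomology ℤ ℤ c.W ((𝓡∂ (n + 1 + 1)).boundary c.W) (n + 1 + 1)}
    (hw : relativeSingularHomology.δ ℤ ℤ c.W ((𝓡∂ (n + 1 + 1)).boundary c.W) (n + 1) w =
      singularHomology.map ℤ ℤ c.inlBoundary (n + 1) μ.fundamentalClass -
        singularHomology.map ℤ ℤ c.inrBoundary (n + 1) ν.fundamentalClass) :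
    IsRelFundamentalClass ℤ ((𝓡∂ (n + 1 + 1)).boundary c.W) w := by
  have hinf : (∞ : WithTop ℕ∞) ≠ 0 := by simp
  refine isRelFundamentalClass_of_isGenerator_toLocal_δ_of_isManifold (R := ℤ) hinf n.succ_ne_zero w ?_ ?_
  · exact c.toBoundarySplitting.isGenerator_toLocal_of_eq_sub μ ν
      (HomologicalOrientation.isFundamentalClass_fundamentalClass_holds (R := ℤ) (X := M) (n + 1) μ)
      (HomologicalOrientation.isFundamentalClass_fundamentalClass_holds (R := ℤ) (X := N) (n + 1) ν)
      _ hw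
  · intro x
    obtain ⟨m⟩ := (inferInstance : Nonempty M)
    exact ⟨c.inl m, c.inl_mem_boundary m,
      PreconnectedSpace.connectedComponent_eq_univ x ▸ mem_univ _⟩

end RelFundamental

/-! ### The cylinder over a connected manifold is connected -/

section CylinderConnected

variable {n : ℕ} {M : Type u} [TopologicalSpace M] [ChartedSpace (EuclideanSpace ℝ (Fin n)) M]

/-- The cylinder `M × [0, 1]` over a connected space is connected. [folklore] -/
instance Cylinder.connectedSpace_carrier [ConnectedSpace M] : ConnectedSpace ↥(Cylinder.carrier M) := by
  have h : Cylinder.carrier M = (univ : Set M) ×ˢ Icc (0 : ℝ) 1 := by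
    ext p
    rw [Cylinder.mem_carrier_iff, mem_prod]
    simp
  rw [h]
  exact isConnected_iff_connectedSpace.1 (isConnected_univ.prod (isConnected_Icc zero_le_one))

end CylinderConnected

/-! ### O2. A relative fundamental class makes a null-cobordism an oriented null-bordism -/

section OrientedNull

variable {n : ℕ} {M : Type} [TopologicalSpace M] [T2Space M] [CompactSpace M]
  [ChartedSpace (EuclideanSpace ℝ (Fin (n + 1))) M] [IsManifold (𝓡 (n + 1)) ∞ M]

omit [T2Space M] [CompactSpace M] [IsManifold (𝓡 (n + 1)) ∞ M] in
/-- **A compact smooth manifold with boundary carrying a relative fundamental class is an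
oriented null-bordism of its boundary, with the boundary orientation** (Spanier 1981, Ch. 6 §3
Cor. 10: `∂[W, ∂W]` is a fundamental class of `∂W`; Hatcher 2002, p. 253).  For a null-cobordism
`c` of `M` (`∂W ≅ M` by `c.bdryHomeomorph`) and a relative fundamental class `w`, the
orientation `θ = (∂-orientation of w).comap (c.bdryHomeomorph)` of `M` satisfies
`IsOrientedBordant (n + 1) θ ε` for every orientation `ε` of an empty manifold: through the
cobordism `(W; M, ∅)` and the class `w` itself, `∂w = [∂W] = incl_* [M]_θ`
(`boundaryOrientation_fundamentalClass_eq`, `fundamentalClass_comap_holds`).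
[cite: Spanier1981, Ch. 6 Sec. 3 Cor. 10] -/
theorem NullCobordism.isOrientedBordant_boundaryOrientation_comap (c : NullCobordism (n + 1) M)
    {w : relativeSingularHomology ℤ ℤ c.W ((𝓡∂ (n + 1 + 1)).boundary c.W) (n + 1 + 1)}
    (hw : IsRelFundamentalClass ℤ ((𝓡∂ (n + 1 + 1)).boundary c.W) w)
    {E : Type} [TopologicalSpace E] [ChartedSpace (EuclideanSpace ℝ (Fin (n + 1))) E] [IsEmpty E]
    (ε : HomologicalOrientation ℤ E (n + 1)) :
    IsOrientedBordant (n + 1) ((boundaryOrientation ℤ n.succ_ne_zero hw).comap c.bdryHomeomorph) ε := by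
  haveI : CompactSpace ↥((𝓡∂ (n + 1 + 1)).boundary c.W) :=
    isCompact_iff_compactSpace.1 (ModelWithCorners.isClosed_boundary (I := 𝓡∂ (n + 1 + 1))
      (M := c.W) (n := 1) one_ne_zero).isCompact
  refine ⟨c.toCobordism E, w, ?_⟩
  rw [ε.fundamentalClass_eq_zero_of_isEmpty, map_zero, sub_zero,
    HomologicalOrientation.fundamentalClass_comap_holds (R := ℤ) (X := ↥((𝓡∂ (n + 1 + 1)).boundary c.W))
      (Y := M) (n + 1) _ c.bdryHomeomorph,
    boundaryOrientation_fundamentalClass_eq ℤ n.succ_ne_zero hw, ← ModuleCat.comp_apply]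
  have hcomp : (singularHomology.mapIso ℤ ℤ c.bdryHomeomorph (n + 1)).inv ≫
      singularHomology.map ℤ ℤ (c.toCobordism E).inlBoundary (n + 1) = 𝟙 _ := by
    have he : ((c.toCobordism E).inlBoundary).comp
        ((c.bdryHomeomorph.symm : ↥((𝓡∂ (n + 1 + 1)).boundary c.W) ≃ₜ M) :
          C(↥((𝓡∂ (n + 1 + 1)).boundary c.W), M)) =
        ContinuousMap.id _ := by
      ext x : 2
      exact congrArg Subtype.val (c.bdryHomeomorph.apply_symm_apply x)
    rw [singularHomology.mapIso_inv]
    change singularHomology.map ℤ ℤ _ (n + 1) ≫ _ = _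
    rw [← singularHomology.map_comp, he]
    exact singularHomology.map_id ℤ ℤ (n + 1)
  rw [hcomp]
  rfl

end OrientedNull

/-! ### O3. Pull-back of orientations along open embeddings; orientations of a sum -/

section Pullback

variable {k : ℕ} {X M : Type} [TopologicalSpace X] [TopologicalSpace M] [T2Space X] [T2Space M]
  [ChartedSpace (EuclideanSpace ℝ (Fin k)) X] [ChartedSpace (EuclideanSpace ℝ (Fin k)) M]

/-- **Pull-back of a homological orientation along an open embedding** (local orientations are
local: Hatcher 2002, §3.3 p. 231, excision `Hₖ(X | x) ≅ Hₖ(M | f x)`): the local class at `x`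
is `μ_{f x}` pulled back along the excision isomorphism; local consistency by
`LocalFamily.ConsistentOn.preimage_of_isOpenEmbedding` on a compact neighbourhood.  Generalises
the tree's `HomologicalOrientation.restrictOpens` (the case `f = Subtype.val`).
[cite: HatcherAT2002, §3.3 p. 231] -/
def _root_.Literature.AlgebraicTopology.SingularHomology.HomologicalOrientation.pullback
    (μ : HomologicalOrientation ℤ M k) (f : C(X, M)) (hf : IsOpenEmbedding f) :
    HomologicalOrientation ℤ X k :=
  haveI hiso := fun x : X => localHomology.isIso_map_of_isOpenEmbedding_of_eq ℤ ℤ f hf x rfl k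
  HomologicalOrientation.ofLocalFamily
    (fun x => inv (relativeSingularHomology.map ℤ ℤ f (LocalFamily.mapsTo_compl_pt hf.injective x) k)
      (μ.localClass (f x)))
    (fun x => (exists_linearEquiv_apply_eq_one_iff_of_isIso
      (relativeSingularHomology.map ℤ ℤ f (LocalFamily.mapsTo_compl_pt hf.injective x) k) _).1 (by
        rw [← ModuleCat.comp_apply, IsIso.inv_hom_id, ModuleCat.id_apply]
        exact μ.isGenerator (f x)))
    (by
      intro x
      haveI := ChartedSpace.locallyCompactSpace (EuclideanSpace ℝ (Fin k)) X
      obtain ⟨N, hN, hNμ⟩ := μ.consistentOn_nhds (f x)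
      have hUN : f ⁻¹' N ∈ 𝓝 x := hf.continuous.continuousAt.preimage_mem_nhds hN
      obtain ⟨K, hKn, hKU, hKc⟩ := local_compact_nhds hUN
      refine ⟨K, hKn, ?_⟩
      refine LocalFamily.ConsistentOn.preimage_of_isOpenEmbedding
        (β := (μ.localClass : LocalFamily ℤ ℤ M k)) f hf ?_ ?_ ?_
      · rw [(hKc.image hf.continuous).isClosed.closure_eq]
        rintro _ ⟨z, -, rfl⟩
        exact mem_range_self z
      · exact hNμ.mono (image_subset_iff.2 hKU)
      · intro y _
        rw [← ModuleCat.comp_apply, IsIso.inv_hom_id, ModuleCat.id_apply])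

omit [T2Space X] [ChartedSpace (EuclideanSpace ℝ (Fin k)) M] in
/-- Defining property of the pull-back: `f_* ((f^* μ)_x) = μ_{f x}`. [cite: HatcherAT2002, §3.3 p. 231] -/
theorem _root_.Literature.AlgebraicTopology.SingularHomology.HomologicalOrientation.map_pullback_localClass
    (μ : HomologicalOrientation ℤ M k) (f : C(X, M)) (hf : IsOpenEmbedding f) (x : X) :
    relativeSingularHomology.map ℤ ℤ f (LocalFamily.mapsTo_compl_pt hf.injective x) k
      ((μ.pullback f hf).localClass x) = μ.localClass (f x) := by
  haveI := localHomology.isIso_map_of_isOpenEmbedding_of_eq ℤ ℤ f hf x rfl k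
  change relativeSingularHomology.map ℤ ℤ f _ k
    (inv (relativeSingularHomology.map ℤ ℤ f (LocalFamily.mapsTo_compl_pt hf.injective x) k)
      (μ.localClass (f x))) = _
  rw [← ModuleCat.comp_apply, IsIso.inv_hom_id, ModuleCat.id_apply]

end Pullback

section SumPullback

variable {k : ℕ} {X Y : Type} [TopologicalSpace X] [TopologicalSpace Y] [T2Space X] [T2Space Y]
  [ChartedSpace (EuclideanSpace ℝ (Fin k)) X] [ChartedSpace (EuclideanSpace ℝ (Fin k)) Y]

omit [ChartedSpace (EuclideanSpace ℝ (Fin k)) Y] in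
/-- **Every orientation of `X ⊔ Y` is the sum of its restrictions** (incoming summand): with
`Θ|_X := Θ.pullback inl`, `Θ_{inl x} = (inl)_* ((Θ|_X)_x)` — the characterising property `h₁` of
the sum orientation of `BordismFourDisjointUnion`. [cite: HatcherAT2002, §3.3 p. 231] -/
theorem localClass_inl_eq_map_pullback (Θ : HomologicalOrientation ℤ (X ⊕ Y) k) (x : X) :
    Θ.localClass (Sum.inl x) = relativeSingularHomology.map ℤ ℤ (sumInl X Y)
      (mapsTo_inl_compl_singleton x) k ((Θ.pullback (sumInl X Y) IsOpenEmbedding.inl).localClass x) :=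
  (Θ.map_pullback_localClass (sumInl X Y) IsOpenEmbedding.inl x).symm

omit [ChartedSpace (EuclideanSpace ℝ (Fin k)) X] in
/-- **Every orientation of `X ⊔ Y` is the sum of its restrictions** (outgoing summand).
[cite: HatcherAT2002, §3.3 p. 231] -/
theorem localClass_inr_eq_map_pullback (Θ : HomologicalOrientation ℤ (X ⊕ Y) k) (y : Y) :
    Θ.localClass (Sum.inr y) = relativeSingularHomology.map ℤ ℤ (sumInr X Y)
      (mapsTo_inr_compl_singleton y) k ((Θ.pullback (sumInr X Y) IsOpenEmbedding.inr).localClass y) :=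
  (Θ.map_pullback_localClass (sumInr X Y) IsOpenEmbedding.inr y).symm

end SumPullback


/-! ### The interior orientation of a null-cobordism carrying a relative fundamental class -/

namespace NullCobordism

variable {m : ℕ} {MP : Type} [TopologicalSpace MP] [ChartedSpace (EuclideanSpace ℝ (Fin (m + 1))) MP]
  [IsManifold (𝓡 (m + 1)) ∞ MP] [CompactSpace MP]

/-- The identity piece of a null-cobordism (`A = W`, `j = val`). [folklore] -/
def idPiece (c : NullCobordism (m + 1) MP) : Piece c c where
  A := ⊤
  j := ⟨Subtype.val, continuous_subtype_val⟩
  isOpenEmbedding_j := (⊤ : Opens c.W).isOpen.isOpenEmbedding_subtypeVal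
  mem_boundary_iff _ := Iff.rfl

/-- **The interior orientation of a null-cobordism with a relative fundamental class** (Hatcher
2002, p. 253: `[W, ∂W]` restricts to an orientation of `W ∖ ∂W`): the local classes
`v ↦ w|_v` of `w` at interior points, read on the interior manifold `X = W ∖ ∂W`
(`Piece.interiorFamily` of the identity piece; generators and local consistency by
`Piece.isGenerator_interiorFamily`, `Piece.consistentOn_interiorFamily_nhds`).
[cite: HatcherAT2002, §3.3 p. 253] -/
def interiorOrientation (c : NullCobordism (m + 1) MP)
    {w : relativeSingularHomology ℤ ℤ c.W ((𝓡∂ (m + 1 + 1)).boundary c.W) (m + 1 + 1)}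
    (hw : IsRelFundamentalClass ℤ ((𝓡∂ (m + 1 + 1)).boundary c.W) w) :
    HomologicalOrientation ℤ c.Interior (m + 1 + 1) :=
  HomologicalOrientation.ofLocalFamily (c.idPiece.interiorFamily w)
    (fun v => c.idPiece.isGenerator_interiorFamily hw ⟨v.val, trivial⟩
      (by rw [ModelWithCorners.compl_boundary]; exact v.val_mem_interior) v rfl)
    (fun v => c.idPiece.consistentOn_interiorFamily_nhds w ⟨v.val, trivial⟩ v.val_mem_interior v rfl)

omit [IsManifold (𝓡 (m + 1)) ∞ MP] [CompactSpace MP] in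
/-- Defining property of the interior orientation: `val_* (ν_v) = w|_v`.
[cite: HatcherAT2002, §3.3 p. 253] -/
theorem map_val_interiorOrientation_localClass (c : NullCobordism (m + 1) MP)
    {w : relativeSingularHomology ℤ ℤ c.W ((𝓡∂ (m + 1 + 1)).boundary c.W) (m + 1 + 1)}
    (hw : IsRelFundamentalClass ℤ ((𝓡∂ (m + 1 + 1)).boundary c.W) w) (v : c.Interior) :
    relativeSingularHomology.map ℤ ℤ c.valCM (c.mapsTo_val_compl_singleton v) (m + 1 + 1)
      ((c.interiorOrientation hw).localClass v) =
      relativeSingularHomology.toLocal ℤ ℤ _ ⟨v.val, v.val_notMem_boundary⟩ (m + 1 + 1) w := by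
  change relativeSingularHomology.map ℤ ℤ c.valCM _ (m + 1 + 1) (c.idPiece.interiorFamily w v) = _
  rw [Piece.map_val_interiorFamily]
  exact (Piece.ambientFamily_apply c.idPiece w ⟨v.val, trivial⟩).trans
    (Piece.map_ι_pieceClass_of_mem c.idPiece w ⟨v.val, trivial⟩ v.val_notMem_boundary)

end NullCobordism


/-! ### O4a. The open unit half-ball, its inversion, and half-ball orientations -/

section HalfBall

variable {n : ℕ}

/-- The open unit half-ball is open. [folklore] -/
theorem isOpen_halfBall : IsOpen (NullCobordism.BCSSetup.halfBall n) := by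
  have h1 : IsOpen {v : EuclideanSpace ℝ (Fin (n + 2)) | ‖v‖ < 1} :=
    isOpen_lt continuous_norm continuous_const
  have h2 : IsOpen {v : EuclideanSpace ℝ (Fin (n + 2)) | 0 < v 0} :=
    isOpen_lt continuous_const (EuclideanSpace.proj (0 : Fin (n + 2))).continuous
  exact h1.inter h2

/-- The open unit half-ball as an open subset of `ℝⁿ⁺²` (so that it is a smooth manifold charted on
`ℝⁿ⁺²`). [folklore] -/
def halfBallOpens (n : ℕ) : Opens (EuclideanSpace ℝ (Fin (n + 2))) :=
  ⟨NullCobordism.BCSSetup.halfBall n, isOpen_halfBall⟩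

/-- **The Kervaire–Milnor inversion of the half-ball**: `v ↦ ((1 - ‖v‖)/‖v‖) • v`, i.e.
`t • u ↦ (1 - t) • u` for unit `u` (the tree's `discInversionFun`), an involution of the open
unit half-ball exchanging the two half-discs of a boundary connected sum
(`boundaryConnectedSumRel`). [cite: KervaireMilnor1963, §2] -/
def halfBallInversion (n : ℕ) : ↥(halfBallOpens n) ≃ₜ ↥(halfBallOpens n) where
  toFun v := ⟨discInversionFun v.1, by
    have hv0 : (v.1 : EuclideanSpace ℝ (Fin (n + 2))) ≠ 0 := fun h => by
      have := v.2.2; rw [h] at this; exact lt_irrefl _ this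
    refine ⟨?_, ?_⟩
    · have := norm_discInversionFun hv0 v.2.1.le
      rw [this]; linarith [norm_pos_iff.2 hv0]
    · change 0 < (((1 - ‖(v.1 : EuclideanSpace ℝ (Fin (n + 2)))‖) * ‖(v.1 : EuclideanSpace ℝ (Fin (n + 2)))‖⁻¹) • (v.1 : EuclideanSpace ℝ (Fin (n + 2)))) 0
      rw [PiLp.smul_apply, smul_eq_mul]
      exact mul_pos (mul_pos (by linarith [v.2.1]) (inv_pos.2 (norm_pos_iff.2 hv0))) v.2.2⟩
  invFun v := ⟨discInversionFun v.1, by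
    have hv0 : (v.1 : EuclideanSpace ℝ (Fin (n + 2))) ≠ 0 := fun h => by
      have := v.2.2; rw [h] at this; exact lt_irrefl _ this
    refine ⟨?_, ?_⟩
    · have := norm_discInversionFun hv0 v.2.1.le
      rw [this]; linarith [norm_pos_iff.2 hv0]
    · change 0 < (((1 - ‖(v.1 : EuclideanSpace ℝ (Fin (n + 2)))‖) * ‖(v.1 : EuclideanSpace ℝ (Fin (n + 2)))‖⁻¹) • (v.1 : EuclideanSpace ℝ (Fin (n + 2)))) 0
      rw [PiLp.smul_apply, smul_eq_mul]
      exact mul_pos (mul_pos (by linarith [v.2.1]) (inv_pos.2 (norm_pos_iff.2 hv0))) v.2.2⟩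
  left_inv v := Subtype.ext (discInversionFun_discInversionFun
    (fun h => by have := v.2.2; rw [h] at this; exact lt_irrefl _ this) v.2.1)
  right_inv v := Subtype.ext (discInversionFun_discInversionFun
    (fun h => by have := v.2.2; rw [h] at this; exact lt_irrefl _ this) v.2.1)
  continuous_toFun := by
    refine Continuous.subtype_mk ?_ _
    exact contDiffOn_discInversionFun.continuousOn.comp_continuous continuous_subtype_val
      fun v h => by have := v.2.2; rw [show (v.1 : EuclideanSpace ℝ (Fin (n + 2))) = 0 from h] at this; exact lt_irrefl _ this
  continuous_invFun := by
    refine Continuous.subtype_mk ?_ _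
    exact contDiffOn_discInversionFun.continuousOn.comp_continuous continuous_subtype_val
      fun v h => by have := v.2.2; rw [show (v.1 : EuclideanSpace ℝ (Fin (n + 2))) = 0 from h] at this; exact lt_irrefl _ this

/-- The value of the inversion. [folklore] -/
theorem coe_halfBallInversion (v : ↥(halfBallOpens n)) :
    ((halfBallInversion n v : ↥(halfBallOpens n)) : EuclideanSpace ℝ (Fin (n + 2))) = discInversionFun v.1 := rfl

end HalfBall

namespace NullCobordism

variable {n : ℕ} {M : Type} [TopologicalSpace M] [ChartedSpace (EuclideanSpace ℝ (Fin (n + 1))) M]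
  [IsManifold (𝓡 (n + 1)) ∞ M] [CompactSpace M] [T2Space M]

/-- **The half-ball map of a collar half-disc**: `v ↦ κ.halfDisc i v` on the open unit half-ball,
with values in the interior of `W` (positive first coordinate, `halfDisc_mem_boundary_iff`).
[cite: Hirsch1976, §4.6] -/
def halfBallMap (c : NullCobordism (n + 1) M) (κ : c.boundaryData.Collar)
    {i : EuclideanSpace ℝ (Fin (n + 1)) → M} (hi : Manifold.IsSmoothEmbedding (𝓡 (n + 1)) (𝓡 (n + 1)) ∞ i)
    (v : ↥(halfBallOpens n)) : c.Interior :=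
  ⟨κ.halfDisc i (BCSSetup.toHalfSpace v), by
    have hk := κ.isSmoothEmbedding_halfDisc hi (isOpen_range_of_isSmoothEmbedding_disc hi)
    have hnb : κ.halfDisc i (BCSSetup.toHalfSpace v) ∉ (𝓡∂ (n + 2)).boundary c.W := by
      rw [halfDisc_mem_boundary_iff hk.1 hk.2]; exact v.2.2.ne'
    exact (ModelWithCorners.isInteriorPoint_iff_not_isBoundaryPoint _).2 hnb⟩

omit [CompactSpace M] [T2Space M] in
/-- The value of the half-ball map in `W`. [folklore] -/
@[simp] theorem halfBallMap_val (c : NullCobordism (n + 1) M) (κ : c.boundaryData.Collar)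
    {i : EuclideanSpace ℝ (Fin (n + 1)) → M} (hi : Manifold.IsSmoothEmbedding (𝓡 (n + 1)) (𝓡 (n + 1)) ∞ i)
    (v : ↥(halfBallOpens n)) : (c.halfBallMap κ hi v).val = κ.halfDisc i (BCSSetup.toHalfSpace v) := rfl

/-- `toHalfSpace` is an open embedding of the open unit half-ball into the closed half-space. [folklore] -/
theorem isOpenEmbedding_toHalfSpace : IsOpenEmbedding (BCSSetup.toHalfSpace (n := n)) := by
  refine ⟨BCSSetup.isEmbedding_toHalfSpace, ?_⟩
  have hr : range (BCSSetup.toHalfSpace (n := n)) =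
      Subtype.val ⁻¹' NullCobordism.BCSSetup.halfBall n := by
    ext x
    constructor
    · rintro ⟨v, rfl⟩; exact v.2
    · intro hx; exact ⟨⟨x.val, hx⟩, rfl⟩
  rw [hr]
  exact isOpen_halfBall.preimage continuous_subtype_val

omit [CompactSpace M] [T2Space M] in
/-- The half-ball map is an open embedding into the interior manifold. [folklore] -/
theorem isOpenEmbedding_halfBallMap (c : NullCobordism (n + 1) M) (κ : c.boundaryData.Collar)
    {i : EuclideanSpace ℝ (Fin (n + 1)) → M} (hi : Manifold.IsSmoothEmbedding (𝓡 (n + 1)) (𝓡 (n + 1)) ∞ i) :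
    IsOpenEmbedding (c.halfBallMap κ hi) := by
  have hk := κ.isSmoothEmbedding_halfDisc hi (isOpen_range_of_isSmoothEmbedding_disc hi)
  have h : IsOpenEmbedding (InteriorManifold.val ∘ c.halfBallMap κ hi) :=
    (IsOpenEmbedding.mk hk.1.isEmbedding hk.2).comp isOpenEmbedding_toHalfSpace
  exact IsOpenEmbedding.of_comp _ InteriorManifold.isOpenEmbedding_val h

/-- The half-ball map as a continuous map. [folklore] -/
def halfBallMapC (c : NullCobordism (n + 1) M) (κ : c.boundaryData.Collar)
    {i : EuclideanSpace ℝ (Fin (n + 1)) → M} (hi : Manifold.IsSmoothEmbedding (𝓡 (n + 1)) (𝓡 (n + 1)) ∞ i) :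
    C(↥(halfBallOpens n), c.Interior) :=
  ⟨c.halfBallMap κ hi, (c.isOpenEmbedding_halfBallMap κ hi).continuous⟩

/-- **The half-ball orientation** of an oriented null-cobordism at a boundary disc: the interior
orientation of `(W, w)` pulled back along the collar half-disc over the disc `i`, to the open unit
half-ball. [cite: KervaireMilnorAnnals1963, §2 pp. 507–508] -/
def halfBallOrientation (c : NullCobordism (n + 1) M) (κ : c.boundaryData.Collar)
    {i : EuclideanSpace ℝ (Fin (n + 1)) → M} (hi : Manifold.IsSmoothEmbedding (𝓡 (n + 1)) (𝓡 (n + 1)) ∞ i)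
    {w : relativeSingularHomology ℤ ℤ c.W ((𝓡∂ (n + 1 + 1)).boundary c.W) (n + 1 + 1)}
    (hw : IsRelFundamentalClass ℤ ((𝓡∂ (n + 1 + 1)).boundary c.W) w) :
    HomologicalOrientation ℤ ↥(halfBallOpens n) (n + 1 + 1) :=
  (c.interiorOrientation hw).pullback (c.halfBallMapC κ hi) (c.isOpenEmbedding_halfBallMap κ hi)

end NullCobordism


/-! ### O4b. The gluing sign read on the half-ball -/

namespace NullCobordism.BCSSetup

variable {n : ℕ} (X : BCSSetup n)

/-- The half-ball point of the `S`-piece over `v`. [cite: Juhasz2023, Def. 1.47] -/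
def aMap (v : ↥(halfBallOpens n)) : X.pieceS.A :=
  ⟨X.kS (toHalfSpace v), X.kS_mem_puncture (norm_pos_of_mem_halfBall v)⟩

/-- The half-ball point of the `T`-piece over `v`. [cite: Juhasz2023, Def. 1.47] -/
def bMap (v : ↥(halfBallOpens n)) : X.pieceT.A :=
  ⟨X.kT (toHalfSpace v), X.kT_mem_puncture (norm_pos_of_mem_halfBall v)⟩

/-- `aMap` is continuous. [folklore] -/
theorem continuous_aMap : Continuous X.aMap :=
  ((X.isSmoothEmbedding_kS.1.isEmbedding.continuous.comp isEmbedding_toHalfSpace.continuous).subtype_mk _)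

/-- `bMap` is continuous. [folklore] -/
theorem continuous_bMap : Continuous X.bMap :=
  ((X.isSmoothEmbedding_kT.1.isEmbedding.continuous.comp isEmbedding_toHalfSpace.continuous).subtype_mk _)

/-- `aMap` as a continuous map. [folklore] -/
def aMapC : C(↥(halfBallOpens n), X.pieceS.A) := ⟨X.aMap, X.continuous_aMap⟩

/-- `bMap` as a continuous map. [folklore] -/
def bMapC : C(↥(halfBallOpens n), X.pieceT.A) := ⟨X.bMap, X.continuous_bMap⟩

/-- `aMap v` is an interior point of `W_S`. [folklore] -/
theorem aMap_mem_compl_boundary (v : ↥(halfBallOpens n)) :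
    ((X.aMap v : X.pieceS.A) : X.cS.W) ∈ ((𝓡∂ (n + 1 + 1)).boundary X.cS.W)ᶜ := by
  change X.kS (toHalfSpace v) ∉ (𝓡∂ (n + 2)).boundary X.cS.W
  rw [halfDisc_mem_boundary_iff X.isSmoothEmbedding_kS.1 X.isSmoothEmbedding_kS.2]
  exact v.2.2.ne'

/-- `bMap v` is an interior point of `W_T`. [folklore] -/
theorem bMap_mem_compl_boundary (v : ↥(halfBallOpens n)) :
    ((X.bMap v : X.pieceT.A) : X.cT.W) ∈ ((𝓡∂ (n + 1 + 1)).boundary X.cT.W)ᶜ := by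
  change X.kT (toHalfSpace v) ∉ (𝓡∂ (n + 2)).boundary X.cT.W
  rw [halfDisc_mem_boundary_iff X.isSmoothEmbedding_kT.1 X.isSmoothEmbedding_kT.2]
  exact v.2.2.ne'

/-- **The gluing identity on the half-ball**: the `T`-point over the inverted parameter is glued
to the `S`-point, `ι₂ (k_T ((1-t)u)) = ι₁ (k_S (t u))` (Juhász 2023, Def. 1.47; the relation
`boundaryConnectedSumRel`). [cite: Juhasz2023, Def. 1.47] -/
theorem j_bMap_halfBallInversion (v : ↥(halfBallOpens n)) :
    X.pieceT.j (X.bMap (halfBallInversion n v)) = X.pieceS.j (X.aMap v) := by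
  change X.W.ι₂ (X.bMap (halfBallInversion n v)) = X.W.ι₁ (X.aMap v)
  symm
  set t : ℝ := ‖(toHalfSpace v).val‖ with ht
  have hv : 0 < t := norm_pos_of_mem_halfBall v
  have hv1 : t < 1 := v.2.1
  let u : EuclideanHalfSpace (n + 2) := EuclideanHalfSpace.dilate t⁻¹ (toHalfSpace v)
  have hu : ‖u.val‖ = 1 := by
    change ‖(EuclideanHalfSpace.dilate t⁻¹ (toHalfSpace v)).val‖ = 1
    rw [EuclideanHalfSpace.val_dilate_of_nonneg (inv_nonneg.2 hv.le), norm_smul,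
      Real.norm_of_nonneg (inv_nonneg.2 hv.le), ← ht, inv_mul_cancel₀ hv.ne']
  have hvu : toHalfSpace v = EuclideanHalfSpace.dilate t u := by
    change toHalfSpace v = EuclideanHalfSpace.dilate t (EuclideanHalfSpace.dilate t⁻¹ (toHalfSpace v))
    rw [EuclideanHalfSpace.dilate_dilate hv.le (inv_nonneg.2 hv.le), mul_inv_cancel₀ hv.ne',
      EuclideanHalfSpace.dilate_one]
  refine (X.W.rel _ _).2 ⟨u, t, hu, ⟨hv, hv1⟩, ?_, ?_⟩
  · change X.kS (toHalfSpace v) = X.kS (EuclideanHalfSpace.dilate t u)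
    rw [← hvu]
  · change X.kT (toHalfSpace (halfBallInversion n v)) = X.kT (EuclideanHalfSpace.dilate (1 - t) u)
    congr 1
    apply EuclideanHalfSpace.ext
    change discInversionFun (v.1 : EuclideanSpace ℝ (Fin (n + 2))) = (EuclideanHalfSpace.dilate (1 - t) u).val
    rw [EuclideanHalfSpace.val_dilate_of_nonneg (by linarith)]
    change ((1 - ‖(v.1 : EuclideanSpace ℝ (Fin (n + 2)))‖) * ‖(v.1 : EuclideanSpace ℝ (Fin (n + 2)))‖⁻¹) • (v.1 : EuclideanSpace ℝ (Fin (n + 2))) =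
      (1 - t) • (EuclideanHalfSpace.dilate t⁻¹ (toHalfSpace v)).val
    rw [EuclideanHalfSpace.val_dilate_of_nonneg (inv_nonneg.2 hv.le), smul_smul]

/-- The overlap parametrisation `θ = j_S ∘ aMap` is an open embedding. [folklore] -/
theorem isOpenEmbedding_j_comp_aMap : IsOpenEmbedding (X.pieceS.j ∘ X.aMap) := by
  show IsOpenEmbedding X.θ
  refine ⟨X.isEmbedding_θ, ?_⟩
  have hr : range X.θ = (range X.W.ι₁ ∩ range X.W.ι₂) ∩ (𝓡∂ (n + 2)).interior X.P := by
    ext p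
    constructor
    · rintro ⟨v, rfl⟩; exact ⟨X.θ_mem_inter v, X.θ_mem_interior v⟩
    · rintro ⟨hp, hpi⟩; exact X.exists_θ_eq hp hpi
  rw [hr]
  exact (X.W.h₁o.inter X.W.h₂o).inter
    (InteriorManifold.isOpen_interior_carrier (I := 𝓡∂ (n + 2)) (M := X.P))

/-- **The pieces' classes over the half-ball are the half-ball orientations**: on the `S`-piece,
`ι_* (pieceClass w_S (aMap v)) = (ι ∘ aMap)_* (b_S)_v` — both are `w_S|` at the point. [folklore] -/
theorem map_pieceClass_aMap {wS : relativeSingularHomology ℤ ℤ X.cS.W ((𝓡∂ (n + 1 + 1)).boundary X.cS.W) (n + 1 + 1)}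
    (hwS : IsRelFundamentalClass ℤ ((𝓡∂ (n + 1 + 1)).boundary X.cS.W) wS) (v : ↥(halfBallOpens n))
    (h' : MapsTo X.aMapC ({v}ᶜ : Set ↥(halfBallOpens n)) ({X.aMap v}ᶜ : Set X.pieceS.A)) :
    relativeSingularHomology.map ℤ ℤ X.pieceS.ι (LocalFamily.mapsTo_compl_pt X.pieceS.ι_injective (X.aMap v))
      (n + 1 + 1) (X.pieceS.pieceClass wS (X.aMap v)) =
    relativeSingularHomology.map ℤ ℤ X.pieceS.ι (LocalFamily.mapsTo_compl_pt X.pieceS.ι_injective (X.aMap v))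
      (n + 1 + 1) (relativeSingularHomology.map ℤ ℤ X.aMapC h' (n + 1 + 1)
        ((X.cS.halfBallOrientation X.κS X.hiS hwS).localClass v)) := by
  have hfac : X.pieceS.ι.comp X.aMapC = X.cS.valCM.comp (X.cS.halfBallMapC X.κS X.hiS) := by
    ext w : 1; rfl
  have hh := LocalFamily.mapsTo_compl_pt (X.cS.isOpenEmbedding_halfBallMap X.κS X.hiS).injective v
  have hv := X.cS.mapsTo_val_compl_singleton (X.cS.halfBallMap X.κS X.hiS v)
  set x := (X.cS.halfBallOrientation X.κS X.hiS hwS).localClass v with hx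
  have e1 : relativeSingularHomology.map ℤ ℤ X.pieceS.ι
      (LocalFamily.mapsTo_compl_pt X.pieceS.ι_injective (X.aMap v)) (n + 1 + 1)
        (relativeSingularHomology.map ℤ ℤ X.aMapC h' (n + 1 + 1) x) =
      relativeSingularHomology.map ℤ ℤ (X.pieceS.ι.comp X.aMapC)
        ((LocalFamily.mapsTo_compl_pt X.pieceS.ι_injective (X.aMap v)).comp h') (n + 1 + 1) x := by
    rw [relativeSingularHomology.map_comp]; rfl
  have e2 : relativeSingularHomology.map ℤ ℤ (X.pieceS.ι.comp X.aMapC)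
        ((LocalFamily.mapsTo_compl_pt X.pieceS.ι_injective (X.aMap v)).comp h') (n + 1 + 1) x =
      relativeSingularHomology.map ℤ ℤ (X.cS.valCM.comp (X.cS.halfBallMapC X.κS X.hiS))
        (hv.comp hh) (n + 1 + 1) x :=
    congrArg (fun f : (localHomology ℤ ℤ ↥(halfBallOpens n) v (n + 1 + 1) ⟶ _) => f x)
      (relativeSingularHomology.map_congr_left (R := ℤ) (M := ℤ) hfac _ (hv.comp hh) (n + 1 + 1))
  have e3 : relativeSingularHomology.map ℤ ℤ (X.cS.valCM.comp (X.cS.halfBallMapC X.κS X.hiS))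
        (hv.comp hh) (n + 1 + 1) x =
      relativeSingularHomology.map ℤ ℤ X.cS.valCM hv (n + 1 + 1)
        (relativeSingularHomology.map ℤ ℤ (X.cS.halfBallMapC X.κS X.hiS) hh (n + 1 + 1) x) := by
    rw [relativeSingularHomology.map_comp]; rfl
  have e4 : relativeSingularHomology.map ℤ ℤ (X.cS.halfBallMapC X.κS X.hiS) hh (n + 1 + 1) x =
      (X.cS.interiorOrientation hwS).localClass (X.cS.halfBallMap X.κS X.hiS v) :=
    HomologicalOrientation.map_pullback_localClass _ _ _ v
  have e5 := X.cS.map_val_interiorOrientation_localClass hwS (X.cS.halfBallMap X.κS X.hiS v)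
  rw [Piece.map_ι_pieceClass_of_mem X.pieceS wS (X.aMap v) (X.aMap_mem_compl_boundary v), e1, e2, e3, e4,
    e5]
  rfl

/-- On the `T`-piece, `ι_* (pieceClass w_T (bMap v)) = (ι ∘ bMap)_* (b_T)_v`. [folklore] -/
theorem map_pieceClass_bMap {wT : relativeSingularHomology ℤ ℤ X.cT.W ((𝓡∂ (n + 1 + 1)).boundary X.cT.W) (n + 1 + 1)}
    (hwT : IsRelFundamentalClass ℤ ((𝓡∂ (n + 1 + 1)).boundary X.cT.W) wT) (v : ↥(halfBallOpens n))
    (h' : MapsTo X.bMapC ({v}ᶜ : Set ↥(halfBallOpens n)) ({X.bMap v}ᶜ : Set X.pieceT.A)) :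
    relativeSingularHomology.map ℤ ℤ X.pieceT.ι (LocalFamily.mapsTo_compl_pt X.pieceT.ι_injective (X.bMap v))
      (n + 1 + 1) (X.pieceT.pieceClass wT (X.bMap v)) =
    relativeSingularHomology.map ℤ ℤ X.pieceT.ι (LocalFamily.mapsTo_compl_pt X.pieceT.ι_injective (X.bMap v))
      (n + 1 + 1) (relativeSingularHomology.map ℤ ℤ X.bMapC h' (n + 1 + 1)
        ((X.cT.halfBallOrientation X.κT X.hiT hwT).localClass v)) := by
  have hfac : X.pieceT.ι.comp X.bMapC = X.cT.valCM.comp (X.cT.halfBallMapC X.κT X.hiT) := by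
    ext w : 1; rfl
  have hh := LocalFamily.mapsTo_compl_pt (X.cT.isOpenEmbedding_halfBallMap X.κT X.hiT).injective v
  have hv := X.cT.mapsTo_val_compl_singleton (X.cT.halfBallMap X.κT X.hiT v)
  set x := (X.cT.halfBallOrientation X.κT X.hiT hwT).localClass v with hx
  have e1 : relativeSingularHomology.map ℤ ℤ X.pieceT.ι
      (LocalFamily.mapsTo_compl_pt X.pieceT.ι_injective (X.bMap v)) (n + 1 + 1)
        (relativeSingularHomology.map ℤ ℤ X.bMapC h' (n + 1 + 1) x) =
      relativeSingularHomology.map ℤ ℤ (X.pieceT.ι.comp X.bMapC)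
        ((LocalFamily.mapsTo_compl_pt X.pieceT.ι_injective (X.bMap v)).comp h') (n + 1 + 1) x := by
    rw [relativeSingularHomology.map_comp]; rfl
  have e2 : relativeSingularHomology.map ℤ ℤ (X.pieceT.ι.comp X.bMapC)
        ((LocalFamily.mapsTo_compl_pt X.pieceT.ι_injective (X.bMap v)).comp h') (n + 1 + 1) x =
      relativeSingularHomology.map ℤ ℤ (X.cT.valCM.comp (X.cT.halfBallMapC X.κT X.hiT))
        (hv.comp hh) (n + 1 + 1) x :=
    congrArg (fun f : (localHomology ℤ ℤ ↥(halfBallOpens n) v (n + 1 + 1) ⟶ _) => f x)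
      (relativeSingularHomology.map_congr_left (R := ℤ) (M := ℤ) hfac _ (hv.comp hh) (n + 1 + 1))
  have e3 : relativeSingularHomology.map ℤ ℤ (X.cT.valCM.comp (X.cT.halfBallMapC X.κT X.hiT))
        (hv.comp hh) (n + 1 + 1) x =
      relativeSingularHomology.map ℤ ℤ X.cT.valCM hv (n + 1 + 1)
        (relativeSingularHomology.map ℤ ℤ (X.cT.halfBallMapC X.κT X.hiT) hh (n + 1 + 1) x) := by
    rw [relativeSingularHomology.map_comp]; rfl
  have e4 : relativeSingularHomology.map ℤ ℤ (X.cT.halfBallMapC X.κT X.hiT) hh (n + 1 + 1) x =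
      (X.cT.interiorOrientation hwT).localClass (X.cT.halfBallMap X.κT X.hiT v) :=
    HomologicalOrientation.map_pullback_localClass _ _ _ v
  have e5 := X.cT.map_val_interiorOrientation_localClass hwT (X.cT.halfBallMap X.κT X.hiT v)
  rw [Piece.map_ι_pieceClass_of_mem X.pieceT wT (X.bMap v) (X.bMap_mem_compl_boundary v), e1, e2, e3, e4,
    e5]
  rfl

/-- `aMap` is injective. [folklore] -/
theorem aMap_injective : Injective X.aMap := fun _ _ h =>
  X.isOpenEmbedding_j_comp_aMap.injective (congrArg X.pieceS.j h)

/-- `bMap` is injective. [folklore] -/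
theorem bMap_injective : Injective X.bMap := fun v w h => by
  have h' : X.kT (toHalfSpace v) = X.kT (toHalfSpace w) := congrArg (fun z : X.pieceT.A => (z : X.cT.W)) h
  have h'' := X.isSmoothEmbedding_kT.1.isEmbedding.injective h'
  exact Subtype.ext (congrArg (fun z : EuclideanHalfSpace (n + 2) => z.val) h'')

/-- `pieceClass w_S (aMap v) = (aMap)_* (b_S)_v`. [folklore] -/
theorem pieceClass_aMap_eq {wS : relativeSingularHomology ℤ ℤ X.cS.W ((𝓡∂ (n + 1 + 1)).boundary X.cS.W) (n + 1 + 1)}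
    (hwS : IsRelFundamentalClass ℤ ((𝓡∂ (n + 1 + 1)).boundary X.cS.W) wS) (v : ↥(halfBallOpens n)) :
    X.pieceS.pieceClass wS (X.aMap v) =
      relativeSingularHomology.map ℤ ℤ X.aMapC (LocalFamily.mapsTo_compl_pt X.aMap_injective v) (n + 1 + 1)
        ((X.cS.halfBallOrientation X.κS X.hiS hwS).localClass v) := by
  haveI := localHomology.isIso_map_of_isOpenEmbedding_of_eq ℤ ℤ X.pieceS.ι X.pieceS.isOpenEmbedding_ι
    (X.aMap v) rfl (n + 1 + 1)
  exact ((ModuleCat.mono_iff_injective (relativeSingularHomology.map ℤ ℤ X.pieceS.ι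
    (LocalFamily.mapsTo_compl_pt X.pieceS.ι_injective (X.aMap v)) (n + 1 + 1))).1 inferInstance)
    (X.map_pieceClass_aMap hwS v _)

/-- `pieceClass w_T (bMap v) = (bMap)_* (b_T)_v`. [folklore] -/
theorem pieceClass_bMap_eq {wT : relativeSingularHomology ℤ ℤ X.cT.W ((𝓡∂ (n + 1 + 1)).boundary X.cT.W) (n + 1 + 1)}
    (hwT : IsRelFundamentalClass ℤ ((𝓡∂ (n + 1 + 1)).boundary X.cT.W) wT) (v : ↥(halfBallOpens n)) :
    X.pieceT.pieceClass wT (X.bMap v) =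
      relativeSingularHomology.map ℤ ℤ X.bMapC (LocalFamily.mapsTo_compl_pt X.bMap_injective v) (n + 1 + 1)
        ((X.cT.halfBallOrientation X.κT X.hiT hwT).localClass v) := by
  haveI := localHomology.isIso_map_of_isOpenEmbedding_of_eq ℤ ℤ X.pieceT.ι X.pieceT.isOpenEmbedding_ι
    (X.bMap v) rfl (n + 1 + 1)
  exact ((ModuleCat.mono_iff_injective (relativeSingularHomology.map ℤ ℤ X.pieceT.ι
    (LocalFamily.mapsTo_compl_pt X.pieceT.ι_injective (X.bMap v)) (n + 1 + 1))).1 inferInstance)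
    (X.map_pieceClass_bMap hwT v _)

/-- The glued overlap map `J = j_S ∘ aMap` equals `j_T ∘ bMap ∘ (inversion)⁻¹`. [cite: Juhasz2023, Def. 1.47] -/
theorem jT_comp_bMapC_eq :
    X.pieceT.j.comp X.bMapC =
      (X.pieceS.j.comp X.aMapC).comp ((halfBallInversion n).symm : C(↥(halfBallOpens n), ↥(halfBallOpens n))) := by
  ext w : 1
  change X.pieceT.j (X.bMap w) = X.pieceS.j (X.aMap ((halfBallInversion n).symm w))
  rw [← X.j_bMap_halfBallInversion ((halfBallInversion n).symm w), Homeomorph.apply_symm_apply]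

/-- **The Kervaire–Milnor gluing sign, read on the half-ball.**  If the glued relative
fundamental class `w_U` of `W_S ♮ W_T` matches `w_S` on the `S`-piece and `ε · w_T` on the
`T`-piece (the output of `BCSGluing.exists_isRelFundamentalClass`), then on the open unit
half-ball the half-ball orientation of `(W_S, w_S)` is `ε` times the half-ball orientation of
`(W_T, w_T)` transported along the inversion `t u ↦ (1 - t) u`: both are the local class of `w_U`
at the glued point `ι₁ (k_S (t u)) = ι₂ (k_T ((1 - t) u))`. [cite: KervaireMilnorAnnals1963, §2 pp. 507–508] -/
theorem halfBallOrientation_localClass_eq_smul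
    {wS : relativeSingularHomology ℤ ℤ X.cS.W ((𝓡∂ (n + 1 + 1)).boundary X.cS.W) (n + 1 + 1)}
    {wT : relativeSingularHomology ℤ ℤ X.cT.W ((𝓡∂ (n + 1 + 1)).boundary X.cT.W) (n + 1 + 1)}
    (hwS : IsRelFundamentalClass ℤ ((𝓡∂ (n + 1 + 1)).boundary X.cS.W) wS)
    (hwT : IsRelFundamentalClass ℤ ((𝓡∂ (n + 1 + 1)).boundary X.cT.W) wT) (ε : ℤˣ)
    {wU : relativeSingularHomology ℤ ℤ X.glued.W ((𝓡∂ (n + 1 + 1)).boundary X.glued.W) (n + 1 + 1)}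
    (hS : ∀ (x : X.pieceS.A) (hx : (x : X.cS.W) ∈ ((𝓡∂ (n + 1 + 1)).boundary X.cS.W)ᶜ),
      relativeSingularHomology.toLocal ℤ ℤ _ ⟨X.pieceS.j x, X.pieceS.j_mem_compl_boundary hx⟩ (n + 1 + 1) wU =
        relativeSingularHomology.map ℤ ℤ X.pieceS.j (LocalFamily.mapsTo_compl_pt X.pieceS.j_injective x)
          (n + 1 + 1) (X.pieceS.pieceClass wS x))
    (hT : ∀ (y : X.pieceT.A) (hy : (y : X.cT.W) ∈ ((𝓡∂ (n + 1 + 1)).boundary X.cT.W)ᶜ),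
      relativeSingularHomology.toLocal ℤ ℤ _ ⟨X.pieceT.j y, X.pieceT.j_mem_compl_boundary hy⟩ (n + 1 + 1) wU =
        (ε : ℤ) • relativeSingularHomology.map ℤ ℤ X.pieceT.j
          (LocalFamily.mapsTo_compl_pt X.pieceT.j_injective y) (n + 1 + 1) (X.pieceT.pieceClass wT y))
    (v : ↥(halfBallOpens n)) :
    (X.cS.halfBallOrientation X.κS X.hiS hwS).localClass v =
      (ε : ℤ) • ((X.cT.halfBallOrientation X.κT X.hiT hwT).comap (halfBallInversion n)).localClass v := by
  set e := halfBallInversion n with he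
  -- the glued overlap embedding `J = j_S ∘ aMap`
  have hJo : IsOpenEmbedding (X.pieceS.j.comp X.aMapC) := X.isOpenEmbedding_j_comp_aMap
  have hglue : X.pieceT.j (X.bMap (e v)) = X.pieceS.j (X.aMap v) := X.j_bMap_halfBallInversion v
  have h₁ := LocalFamily.mapsTo_compl_pt X.pieceS.j_injective (X.aMap v)
  have h' := LocalFamily.mapsTo_compl_pt X.aMap_injective v
  have h₂ := Literature.AlgebraicTopology.SingularHomology.mapsTo_compl_singleton_of_injective
    X.pieceT.j_injective hglue
  have h'' := LocalFamily.mapsTo_compl_pt X.bMap_injective (e v)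
  have h₃ : MapsTo ((e.symm : ↥(halfBallOpens n) ≃ₜ ↥(halfBallOpens n)) : C(↥(halfBallOpens n), ↥(halfBallOpens n)))
      ({e v}ᶜ : Set ↥(halfBallOpens n)) ({v}ᶜ : Set ↥(halfBallOpens n)) := by
    intro w hw hw'
    apply hw
    rw [mem_singleton_iff] at hw' ⊢
    rw [← hw']
    exact (e.apply_symm_apply w).symm
  -- the two matching identities at the glued point
  have E1 := hS (X.aMap v) (X.aMap_mem_compl_boundary v)
  have E2 : relativeSingularHomology.toLocal ℤ ℤ _ ⟨X.pieceS.j (X.aMap v), X.pieceS.j_mem_compl_boundary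
        (X.aMap_mem_compl_boundary v)⟩ (n + 1 + 1) wU =
      (ε : ℤ) • relativeSingularHomology.map ℤ ℤ X.pieceT.j h₂ (n + 1 + 1) (X.pieceT.pieceClass wT (X.bMap (e v))) := by
    have key : ∀ (q : X.glued.W) (hq : X.pieceT.j (X.bMap (e v)) = q)
        (hqi : q ∈ ((𝓡∂ (n + 1 + 1)).boundary X.glued.W)ᶜ),
        relativeSingularHomology.toLocal ℤ ℤ _ ⟨q, hqi⟩ (n + 1 + 1) wU =
          (ε : ℤ) • relativeSingularHomology.map ℤ ℤ X.pieceT.j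
            (Literature.AlgebraicTopology.SingularHomology.mapsTo_compl_singleton_of_injective
              X.pieceT.j_injective hq) (n + 1 + 1) (X.pieceT.pieceClass wT (X.bMap (e v))) := by
      intro q hq hqi
      subst hq
      exact hT (X.bMap (e v)) (X.bMap_mem_compl_boundary _)
    exact key _ hglue _
  have E3 := E1.symm.trans E2
  -- left side through the half-ball
  have L : relativeSingularHomology.map ℤ ℤ X.pieceS.j h₁ (n + 1 + 1) (X.pieceS.pieceClass wS (X.aMap v)) =
      relativeSingularHomology.map ℤ ℤ (X.pieceS.j.comp X.aMapC) (h₁.comp h') (n + 1 + 1)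
        ((X.cS.halfBallOrientation X.κS X.hiS hwS).localClass v) := by
    rw [X.pieceClass_aMap_eq hwS v, relativeSingularHomology.map_comp]; rfl
  -- right side through the half-ball
  have R1 : relativeSingularHomology.map ℤ ℤ X.pieceT.j h₂ (n + 1 + 1) (X.pieceT.pieceClass wT (X.bMap (e v))) =
      relativeSingularHomology.map ℤ ℤ (X.pieceT.j.comp X.bMapC) (h₂.comp h'') (n + 1 + 1)
        ((X.cT.halfBallOrientation X.κT X.hiT hwT).localClass (e v)) := by
    rw [X.pieceClass_bMap_eq hwT (e v), relativeSingularHomology.map_comp]; rfl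
  have R2 : relativeSingularHomology.map ℤ ℤ (X.pieceT.j.comp X.bMapC) (h₂.comp h'') (n + 1 + 1)
        ((X.cT.halfBallOrientation X.κT X.hiT hwT).localClass (e v)) =
      relativeSingularHomology.map ℤ ℤ ((X.pieceS.j.comp X.aMapC).comp
        ((e.symm : ↥(halfBallOpens n) ≃ₜ ↥(halfBallOpens n)) : C(↥(halfBallOpens n), ↥(halfBallOpens n))))
        ((h₁.comp h').comp h₃) (n + 1 + 1) ((X.cT.halfBallOrientation X.κT X.hiT hwT).localClass (e v)) :=
    congrArg (fun f : (localHomology ℤ ℤ ↥(halfBallOpens n) (e v) (n + 1 + 1) ⟶ _) => f _)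
      (relativeSingularHomology.map_congr_left (R := ℤ) (M := ℤ) X.jT_comp_bMapC_eq _ _ (n + 1 + 1))
  have R3 : relativeSingularHomology.map ℤ ℤ ((X.pieceS.j.comp X.aMapC).comp
        ((e.symm : ↥(halfBallOpens n) ≃ₜ ↥(halfBallOpens n)) : C(↥(halfBallOpens n), ↥(halfBallOpens n))))
        ((h₁.comp h').comp h₃) (n + 1 + 1) ((X.cT.halfBallOrientation X.κT X.hiT hwT).localClass (e v)) =
      relativeSingularHomology.map ℤ ℤ (X.pieceS.j.comp X.aMapC) (h₁.comp h') (n + 1 + 1)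
        (((X.cT.halfBallOrientation X.κT X.hiT hwT).comap e).localClass v) := by
    rw [relativeSingularHomology.map_comp]; rfl
  -- conclude by injectivity of `J_*`
  haveI := localHomology.isIso_map_of_isOpenEmbedding_of_eq ℤ ℤ (X.pieceS.j.comp X.aMapC) hJo v
    (b := X.pieceS.j (X.aMap v)) rfl (n + 1 + 1)
  apply ((ModuleCat.mono_iff_injective (relativeSingularHomology.map ℤ ℤ (X.pieceS.j.comp X.aMapC) (h₁.comp h')
    (n + 1 + 1))).1 inferInstance)
  rw [map_zsmul, ← L, E3, R1, R2, R3]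

end NullCobordism.BCSSetup



/-! ### O4c. Reflections: of the disc, of the half-space, of the half-ball -/

section Reflect

variable {n : ℕ}

/-- The sign vector of the reflection of `ℝᵏ⁺¹` in its first coordinate. [folklore] -/
def reflectSigns (k : ℕ) : Fin (k + 1) → ℝ := fun i => if i = 0 then -1 else 1

/-- **The reflection of `ℝᵏ⁺¹` in the first coordinate**, as a continuous linear map (a diagonal
`±1` matrix). [folklore] -/
def tailReflectCLM (k : ℕ) : EuclideanSpace ℝ (Fin (k + 1)) →L[ℝ] EuclideanSpace ℝ (Fin (k + 1)) :=
  Matrix.toEuclideanCLM (𝕜 := ℝ) (Matrix.diagonal (reflectSigns k))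

/-- Coordinates of the reflection. [folklore] -/
@[simp] theorem tailReflectCLM_apply (k : ℕ) (x : EuclideanSpace ℝ (Fin (k + 1))) (i : Fin (k + 1)) :
    tailReflectCLM k x i = reflectSigns k i * x i := by
  change (WithLp.ofLp (Matrix.toEuclideanCLM (𝕜 := ℝ) (Matrix.diagonal (reflectSigns k)) x)) i = _
  rw [Matrix.ofLp_toEuclideanCLM, Matrix.mulVec_diagonal]

/-- The signs square to one. [folklore] -/
theorem reflectSigns_mul_self (k : ℕ) (i : Fin (k + 1)) : reflectSigns k i * reflectSigns k i = 1 := by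
  unfold reflectSigns; split_ifs <;> norm_num

/-- The reflection is an involution. [folklore] -/
theorem tailReflectCLM_tailReflectCLM (k : ℕ) (x : EuclideanSpace ℝ (Fin (k + 1))) :
    tailReflectCLM k (tailReflectCLM k x) = x := by
  ext i
  rw [tailReflectCLM_apply, tailReflectCLM_apply, ← mul_assoc, reflectSigns_mul_self, one_mul]

/-- The reflection preserves the norm. [folklore] -/
theorem norm_tailReflectCLM (k : ℕ) (x : EuclideanSpace ℝ (Fin (k + 1))) : ‖tailReflectCLM k x‖ = ‖x‖ := by
  rw [EuclideanSpace.norm_eq, EuclideanSpace.norm_eq]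
  congr 1
  refine Finset.sum_congr rfl fun i _ => ?_
  rw [tailReflectCLM_apply, norm_mul, mul_pow]
  have : ‖reflectSigns k i‖ = 1 := by unfold reflectSigns; split_ifs <;> simp
  rw [this, one_pow, one_mul]

/-- The reflection has determinant `-1`. [folklore] -/
theorem det_tailReflectCLM (k : ℕ) :
    LinearMap.det (tailReflectCLM k : EuclideanSpace ℝ (Fin (k + 1)) →ₗ[ℝ] EuclideanSpace ℝ (Fin (k + 1))) = -1 := by
  rw [tailReflectCLM, det_toEuclideanCLM, Matrix.det_diagonal]
  rw [Fin.prod_univ_succ]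
  have h0 : reflectSigns k 0 = -1 := by simp [reflectSigns]
  have h1 : ∀ i : Fin k, reflectSigns k i.succ = 1 := fun i => by simp [reflectSigns, Fin.succ_ne_zero]
  simp [h0, h1]

/-- The reflection as a diffeomorphism of `ℝᵏ⁺¹`. [folklore] -/
def tailReflect (k : ℕ) : EuclideanSpace ℝ (Fin (k + 1)) ≃L[ℝ] EuclideanSpace ℝ (Fin (k + 1)) :=
  ContinuousLinearEquiv.equivOfInverse (tailReflectCLM k) (tailReflectCLM k)
    (tailReflectCLM_tailReflectCLM k) (tailReflectCLM_tailReflectCLM k)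

/-- The value of `tailReflect`. [folklore] -/
@[simp] theorem tailReflect_apply (k : ℕ) (x : EuclideanSpace ℝ (Fin (k + 1))) :
    tailReflect k x = tailReflectCLM k x := rfl

/-- **The ambient reflection of `ℝⁿ⁺²` in the SECOND coordinate** (fixing the first coordinate,
which defines the half-space, and reflecting the tail `ℝⁿ⁺¹` in its first coordinate).
[folklore] -/
def ambReflectCLM (n : ℕ) : EuclideanSpace ℝ (Fin (n + 2)) →L[ℝ] EuclideanSpace ℝ (Fin (n + 2)) :=
  Matrix.toEuclideanCLM (𝕜 := ℝ) (Matrix.diagonal (Fin.cons 1 (reflectSigns n)))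

/-- Coordinates of the ambient reflection. [folklore] -/
@[simp] theorem ambReflectCLM_apply (x : EuclideanSpace ℝ (Fin (n + 2))) (i : Fin (n + 2)) :
    ambReflectCLM n x i = (Fin.cons 1 (reflectSigns n) : Fin (n + 2) → ℝ) i * x i := by
  change (WithLp.ofLp (Matrix.toEuclideanCLM (𝕜 := ℝ) (Matrix.diagonal _) x)) i = _
  rw [Matrix.ofLp_toEuclideanCLM, Matrix.mulVec_diagonal]

/-- The ambient reflection fixes the first coordinate. [folklore] -/
theorem ambReflectCLM_apply_zero (x : EuclideanSpace ℝ (Fin (n + 2))) : ambReflectCLM n x 0 = x 0 := by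
  rw [ambReflectCLM_apply, Fin.cons_zero, one_mul]

/-- The tail of the ambient reflection is the reflection of the tail. [folklore] -/
theorem tail_ambReflectCLM (x : EuclideanSpace ℝ (Fin (n + 2))) :
    BoundaryManifold.tail (n + 1) (ambReflectCLM n x) = tailReflectCLM n (BoundaryManifold.tail (n + 1) x) := by
  ext i
  change ((BoundaryManifold.consCLE (n + 1)).symm (ambReflectCLM n x)).1 i = _
  rw [BoundaryManifold.consCLE_symm_apply_fst_apply, ambReflectCLM_apply, Fin.cons_succ,
    tailReflectCLM_apply]
  rfl

/-- The ambient reflection is an involution. [folklore] -/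
theorem ambReflectCLM_ambReflectCLM (x : EuclideanSpace ℝ (Fin (n + 2))) :
    ambReflectCLM n (ambReflectCLM n x) = x := by
  ext i
  rw [ambReflectCLM_apply, ambReflectCLM_apply, ← mul_assoc]
  refine Fin.cases ?_ (fun j => ?_) i
  · simp
  · rw [Fin.cons_succ, reflectSigns_mul_self, one_mul]

/-- The ambient reflection preserves the norm. [folklore] -/
theorem norm_ambReflectCLM (x : EuclideanSpace ℝ (Fin (n + 2))) : ‖ambReflectCLM n x‖ = ‖x‖ := by
  rw [EuclideanSpace.norm_eq, EuclideanSpace.norm_eq]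
  congr 1
  refine Finset.sum_congr rfl fun i _ => ?_
  rw [ambReflectCLM_apply, norm_mul, mul_pow]
  have : ‖(Fin.cons 1 (reflectSigns n) : Fin (n + 2) → ℝ) i‖ = 1 := by
    refine Fin.cases ?_ (fun j => ?_) i
    · simp
    · rw [Fin.cons_succ]; unfold reflectSigns; split_ifs <;> simp
  rw [this, one_pow, one_mul]

/-- The ambient reflection has determinant `-1`. [folklore] -/
theorem det_ambReflectCLM :
    LinearMap.det (ambReflectCLM n : EuclideanSpace ℝ (Fin (n + 2)) →ₗ[ℝ] EuclideanSpace ℝ (Fin (n + 2))) = -1 := by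
  rw [ambReflectCLM, det_toEuclideanCLM, Matrix.det_diagonal, Fin.prod_univ_succ, Fin.cons_zero, one_mul,
    Fin.prod_univ_succ]
  have h1 : ∀ i : Fin n, (Fin.cons 1 (reflectSigns n) : Fin (n + 2) → ℝ) (Fin.succ i.succ) = 1 := fun i => by
    rw [Fin.cons_succ]; simp [reflectSigns, Fin.succ_ne_zero]
  simp [h1, reflectSigns]

/-- The ambient reflection is smooth-linear: it maps `x` to `x` affinely, `R v + R (w - v) = R w`. [folklore] -/
theorem ambReflectCLM_affine (v w : EuclideanSpace ℝ (Fin (n + 2))) :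
    ambReflectCLM n v + ambReflectCLM n (w - v) = ambReflectCLM n w := by
  rw [map_sub, add_sub_cancel]

/-- **The reflection of the closed half-space** (in the second coordinate). [folklore] -/
def halfSpaceReflect (n : ℕ) (x : EuclideanHalfSpace (n + 2)) : EuclideanHalfSpace (n + 2) :=
  ⟨ambReflectCLM n x.val, by
    change 0 ≤ ambReflectCLM n x.val 0
    rw [ambReflectCLM_apply_zero]; exact x.2⟩

/-- **The reflection of the open unit half-ball** (in the second coordinate), a homeomorphism.
[folklore] -/
def halfBallReflect (n : ℕ) : ↥(halfBallOpens n) ≃ₜ ↥(halfBallOpens n) where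
  toFun v := ⟨ambReflectCLM n v.1, by
    refine ⟨?_, ?_⟩
    · rw [norm_ambReflectCLM]; exact v.2.1
    · exact (ambReflectCLM_apply_zero (v.1 : EuclideanSpace ℝ (Fin (n + 2)))).symm ▸ v.2.2⟩
  invFun v := ⟨ambReflectCLM n v.1, by
    refine ⟨?_, ?_⟩
    · rw [norm_ambReflectCLM]; exact v.2.1
    · exact (ambReflectCLM_apply_zero (v.1 : EuclideanSpace ℝ (Fin (n + 2)))).symm ▸ v.2.2⟩
  left_inv v := Subtype.ext (ambReflectCLM_ambReflectCLM v.1)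
  right_inv v := Subtype.ext (ambReflectCLM_ambReflectCLM v.1)
  continuous_toFun := ((ambReflectCLM n).continuous.comp continuous_subtype_val).subtype_mk _
  continuous_invFun := ((ambReflectCLM n).continuous.comp continuous_subtype_val).subtype_mk _

/-- The value of the half-ball reflection. [folklore] -/
@[simp] theorem coe_halfBallReflect (v : ↥(halfBallOpens n)) :
    ((halfBallReflect n v : ↥(halfBallOpens n)) : EuclideanSpace ℝ (Fin (n + 2))) = ambReflectCLM n v.1 := rfl

/-- `toHalfSpace` intertwines the reflections. [folklore] -/
theorem toHalfSpace_halfBallReflect (v : ↥(halfBallOpens n)) :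
    NullCobordism.BCSSetup.toHalfSpace (halfBallReflect n v) = halfSpaceReflect n (NullCobordism.BCSSetup.toHalfSpace v) :=
  rfl

/-- **The half-ball reflection commutes with the Kervaire–Milnor inversion** (the inversion is
radial, the reflection a linear isometry). [folklore] -/
theorem halfBallReflect_halfBallInversion (v : ↥(halfBallOpens n)) :
    halfBallReflect n (halfBallInversion n v) = halfBallInversion n (halfBallReflect n v) := by
  apply Subtype.ext
  change ambReflectCLM n (discInversionFun v.1) = discInversionFun (ambReflectCLM n v.1)
  unfold discInversionFun
  rw [map_smul, norm_ambReflectCLM]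

/-- **The collar half-disc over a reflected disc is the half-disc precomposed with the
half-space reflection**: `halfDisc (i ∘ r) = halfDisc i ∘ R`. [cite: Hirsch1976, §4.6] -/
theorem halfDisc_comp_tailReflect {A : Type} [TopologicalSpace A] [ChartedSpace (EuclideanHalfSpace (n + 2)) A]
    {b : BoundaryData (𝓡∂ (n + 2)) A (𝓡 (n + 1))} (c : b.Collar) (i : EuclideanSpace ℝ (Fin (n + 1)) → b.carrier)
    (v : EuclideanHalfSpace (n + 2)) :
    c.halfDisc (i ∘ tailReflect n) v = c.halfDisc i (halfSpaceReflect n v) := by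
  rw [BoundaryData.Collar.halfDisc_apply, BoundaryData.Collar.halfDisc_apply]
  unfold halfDiscLift
  congr 2
  · change i (tailReflectCLM n (BoundaryManifold.tail (n + 1) v.val)) = i (BoundaryManifold.tail (n + 1) (ambReflectCLM n v.val))
    rw [tail_ambReflectCLM]
  · change Set.projIcc 0 1 zero_le_one (collarSquash (v.val 0)) =
      Set.projIcc 0 1 zero_le_one (collarSquash (ambReflectCLM n v.val 0))
    rw [ambReflectCLM_apply_zero]

end Reflect

/-! ### O4d. Reflected discs reflect half-ball orientations; the reflection reverses orientations -/

namespace NullCobordism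

variable {n : ℕ} {M : Type} [TopologicalSpace M] [ChartedSpace (EuclideanSpace ℝ (Fin (n + 1))) M]
  [IsManifold (𝓡 (n + 1)) ∞ M] [CompactSpace M] [T2Space M]

omit [IsManifold (𝓡 (n + 1)) ∞ M] [CompactSpace M] [T2Space M] in
/-- A disc precomposed with the reflection is a disc. [folklore] -/
theorem isSmoothEmbedding_comp_tailReflect {i : EuclideanSpace ℝ (Fin (n + 1)) → M}
    (hi : Manifold.IsSmoothEmbedding (𝓡 (n + 1)) (𝓡 (n + 1)) ∞ i) :
    Manifold.IsSmoothEmbedding (𝓡 (n + 1)) (𝓡 (n + 1)) ∞ (i ∘ tailReflect n) :=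
  hi.comp_diffeomorph (tailReflect n).toDiffeomorph

omit [CompactSpace M] [T2Space M] in
/-- The half-ball map of the reflected disc is the half-ball map precomposed with the half-ball
reflection. [folklore] -/
theorem halfBallMap_comp_tailReflect (c : NullCobordism (n + 1) M) (κ : c.boundaryData.Collar)
    {i : EuclideanSpace ℝ (Fin (n + 1)) → M} (hi : Manifold.IsSmoothEmbedding (𝓡 (n + 1)) (𝓡 (n + 1)) ∞ i)
    (v : ↥(halfBallOpens n)) :
    c.halfBallMap κ (isSmoothEmbedding_comp_tailReflect hi) v = c.halfBallMap κ hi (halfBallReflect n v) := by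
  apply InteriorManifold.val_injective
  rw [halfBallMap_val, halfBallMap_val, toHalfSpace_halfBallReflect]
  exact halfDisc_comp_tailReflect κ i _

/-- Pull-back along `f ∘ e` for a homeomorphism `e` is the pull-back along `f` transported along `e`
(pointwise). [folklore] -/
theorem _root_.Literature.AlgebraicTopology.SingularHomology.HomologicalOrientation.pullback_comp_homeomorph_localClass
    {k : ℕ} {X Y Z : Type} [TopologicalSpace X] [TopologicalSpace Y] [TopologicalSpace Z]
    [T2Space X] [T2Space Y] [T2Space Z]
    [ChartedSpace (EuclideanSpace ℝ (Fin k)) X] [ChartedSpace (EuclideanSpace ℝ (Fin k)) Y]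
    [ChartedSpace (EuclideanSpace ℝ (Fin k)) Z]
    (μ : HomologicalOrientation ℤ Z k) (f : C(Y, Z)) (hf : IsOpenEmbedding f) (e : X ≃ₜ Y)
    (g : C(X, Z)) (hg : IsOpenEmbedding g) (hfg : ∀ x, g x = f (e x)) (x : X) :
    (μ.pullback g hg).localClass x = ((μ.pullback f hf).comap e).localClass x := by
  -- compare after `g_*`, an isomorphism
  haveI := localHomology.isIso_map_of_isOpenEmbedding_of_eq ℤ ℤ g hg x rfl k
  apply ((ModuleCat.mono_iff_injective (relativeSingularHomology.map ℤ ℤ g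
    (LocalFamily.mapsTo_compl_pt hg.injective x) k)).1 inferInstance)
  rw [HomologicalOrientation.map_pullback_localClass, HomologicalOrientation.comap_localClass]
  have h₂ : MapsTo ((e.symm : Y ≃ₜ X) : C(Y, X)) ({e x}ᶜ : Set Y) ({x}ᶜ : Set X) := by
    intro w hw hw'; apply hw; rw [mem_singleton_iff] at hw' ⊢; rw [← hw']; exact (e.apply_symm_apply w).symm
  change μ.localClass (g x) = relativeSingularHomology.map ℤ ℤ g _ k
    (relativeSingularHomology.map ℤ ℤ ((e.symm : Y ≃ₜ X) : C(Y, X)) h₂ k ((μ.pullback f hf).localClass (e x)))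
  rw [← ModuleCat.comp_apply, ← relativeSingularHomology.map_comp]
  have hcomp : g.comp ((e.symm : Y ≃ₜ X) : C(Y, X)) = f := by
    ext y : 1
    change g (e.symm y) = f y
    rw [hfg, e.apply_symm_apply]
  have key : ∀ (z : Z) (hz : g x = z) (h : MapsTo f ({e x}ᶜ : Set Y) ({z}ᶜ : Set Z)),
      μ.localClass z = relativeSingularHomology.map ℤ ℤ f h k ((μ.pullback f hf).localClass (e x)) := by
    intro z hz h
    have hz' : f (e x) = z := (hfg x).symm.trans hz
    subst hz'
    exact (μ.map_pullback_localClass f hf (e x)).symm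
  rw [relativeSingularHomology.map_congr_left (R := ℤ) (M := ℤ) hcomp _
    ((Literature.AlgebraicTopology.SingularHomology.mapsTo_compl_singleton_of_injective hf.injective
      (show f (e x) = g x from (hfg x).symm)))]
  exact key (g x) rfl _

omit [CompactSpace M] [T2Space M] in
/-- **Reflecting the disc reflects the half-ball orientation**:
`b(i ∘ r) = b(i) transported along the half-ball reflection`. [cite: KervaireMilnorAnnals1963, §2] -/
theorem halfBallOrientation_comp_tailReflect_localClass (c : NullCobordism (n + 1) M) (κ : c.boundaryData.Collar)
    {i : EuclideanSpace ℝ (Fin (n + 1)) → M} (hi : Manifold.IsSmoothEmbedding (𝓡 (n + 1)) (𝓡 (n + 1)) ∞ i)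
    {w : relativeSingularHomology ℤ ℤ c.W ((𝓡∂ (n + 1 + 1)).boundary c.W) (n + 1 + 1)}
    (hw : IsRelFundamentalClass ℤ ((𝓡∂ (n + 1 + 1)).boundary c.W) w) (v : ↥(halfBallOpens n)) :
    (c.halfBallOrientation κ (isSmoothEmbedding_comp_tailReflect hi) hw).localClass v =
      ((c.halfBallOrientation κ hi hw).comap (halfBallReflect n)).localClass v :=
  HomologicalOrientation.pullback_comp_homeomorph_localClass (c.interiorOrientation hw)
    (c.halfBallMapC κ hi) (c.isOpenEmbedding_halfBallMap κ hi) (halfBallReflect n)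
    (c.halfBallMapC κ (isSmoothEmbedding_comp_tailReflect hi))
    (c.isOpenEmbedding_halfBallMap κ (isSmoothEmbedding_comp_tailReflect hi))
    (c.halfBallMap_comp_tailReflect κ hi) v

end NullCobordism


/-! ### O4e. The half-ball reflection reverses orientations; the sign flip -/

section ReflectReverses

variable {n : ℕ}

/-- The open unit half-ball (as an open submanifold of `ℝⁿ⁺²`) is connected. [folklore] -/
instance connectedSpace_halfBallOpens : ConnectedSpace ↥(halfBallOpens n) :=
  NullCobordism.BCSSetup.connectedSpace_halfBall (n := n)

/-- The open unit half-ball is nonempty. [folklore] -/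
instance nonempty_halfBallOpens : Nonempty ↥(halfBallOpens n) :=
  NullCobordism.BCSSetup.nonempty_halfBall (n := n)

/-- Composition of transports: `(μ.comap e₁).comap e₂ = μ.comap (e₂ ≫ e₁)` (pointwise). [folklore] -/
theorem _root_.Literature.AlgebraicTopology.SingularHomology.HomologicalOrientation.comap_comap_localClass
    {k : ℕ} {X Y Z : Type} [TopologicalSpace X] [TopologicalSpace Y] [TopologicalSpace Z]
    (μ : HomologicalOrientation ℤ Z k) (e₁ : Y ≃ₜ Z) (e₂ : X ≃ₜ Y) (x : X) :
    ((μ.comap e₁).comap e₂).localClass x = (μ.comap (e₂.trans e₁)).localClass x := by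
  simp only [HomologicalOrientation.comap_localClass]
  change relativeSingularHomology.map ℤ ℤ _ _ k (relativeSingularHomology.map ℤ ℤ _ _ k _) =
    relativeSingularHomology.map ℤ ℤ _ _ k _
  rw [← ModuleCat.comp_apply, ← relativeSingularHomology.map_comp]
  rfl

/-- **A linear reflection reverses the orientations of the open unit half-ball**: for every
`ℤ`-orientation `μ` of the half-ball, `μ` transported along the reflection `R` (determinant `-1`)
is `-μ` (Hatcher 2002, §2.2 Exercise 7 / §3.3 p. 233, "reflections reverse local orientations";
via the standard orientation of `ℝⁿ⁺²` restricted to the half-ball and the dichotomy for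
orientations of the connected half-ball). [cite: HatcherAT2002, §3.3 p. 233] -/
theorem comap_halfBallReflect_localClass (μ : HomologicalOrientation ℤ ↥(halfBallOpens n) (n + 2))
    (v : ↥(halfBallOpens n)) :
    (μ.comap (halfBallReflect n)).localClass v = -μ.localClass v := by
  obtain ⟨g⟩ := isOrientableOver_int_euclideanSpace (n + 2)
  set γ : HomologicalOrientation ℤ ↥(halfBallOpens n) (n + 2) := g.restrictOpens (halfBallOpens n) with hγ
  -- the statement for the reference orientation `γ`
  have key : ∀ v : ↥(halfBallOpens n), (γ.comap (halfBallReflect n)).localClass v = -γ.localClass v := by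
    intro v
    set R := halfBallReflect n with hR
    set A := ambReflectCLM n with hA
    have hAinj : Function.Injective A := fun x y h => by
      have := congrArg A h; rwa [ambReflectCLM_ambReflectCLM, ambReflectCLM_ambReflectCLM] at this
    have hdet : LinearMap.det (A : EuclideanSpace ℝ (Fin (n + 2)) →ₗ[ℝ] EuclideanSpace ℝ (Fin (n + 2))) < 0 := by
      rw [hA, det_ambReflectCLM]; norm_num
    have hARv : A ((R v : ↥(halfBallOpens n)) : EuclideanSpace ℝ (Fin (n + 2))) = (v : EuclideanSpace ℝ (Fin (n + 2))) :=
      ambReflectCLM_ambReflectCLM _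
    -- maps of pairs
    have h₁ : MapsTo (HomologicalOrientation.valC (halfBallOpens n)) ({v}ᶜ : Set ↥(halfBallOpens n))
        ({(v : EuclideanSpace ℝ (Fin (n + 2)))}ᶜ : Set (EuclideanSpace ℝ (Fin (n + 2)))) :=
      LocalFamily.mapsTo_compl_pt Subtype.val_injective v
    have h₂ : MapsTo ((R.symm : ↥(halfBallOpens n) ≃ₜ ↥(halfBallOpens n)) : C(↥(halfBallOpens n), ↥(halfBallOpens n)))
        ({R v}ᶜ : Set ↥(halfBallOpens n)) ({v}ᶜ : Set ↥(halfBallOpens n)) := by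
      intro w hw hw'; apply hw; rw [mem_singleton_iff] at hw' ⊢; rw [← hw']; exact (R.apply_symm_apply w).symm
    have h₃ := Literature.AlgebraicTopology.SingularHomology.mapsTo_compl_singleton_of_injective hAinj hARv
    have h₄ : MapsTo (HomologicalOrientation.valC (halfBallOpens n)) ({R v}ᶜ : Set ↥(halfBallOpens n))
        ({((R v : ↥(halfBallOpens n)) : EuclideanSpace ℝ (Fin (n + 2)))}ᶜ : Set (EuclideanSpace ℝ (Fin (n + 2)))) :=
      LocalFamily.mapsTo_compl_pt Subtype.val_injective (R v)
    -- push forward along `val`, an isomorphism on local homology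
    haveI := localHomology.isIso_map_of_isOpenEmbedding_of_eq ℤ ℤ (HomologicalOrientation.valC (halfBallOpens n))
      (HomologicalOrientation.isOpenEmbedding_valC _) v rfl (n + 2)
    apply ((ModuleCat.mono_iff_injective (relativeSingularHomology.map ℤ ℤ
      (HomologicalOrientation.valC (halfBallOpens n)) h₁ (n + 2))).1 inferInstance)
    have E0 : (γ.comap R).localClass v =
        relativeSingularHomology.map ℤ ℤ ((R.symm : ↥(halfBallOpens n) ≃ₜ ↥(halfBallOpens n)) :
          C(↥(halfBallOpens n), ↥(halfBallOpens n))) h₂ (n + 2) (γ.localClass (R v)) := rfl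
    have E1 : relativeSingularHomology.map ℤ ℤ (HomologicalOrientation.valC (halfBallOpens n)) h₁ (n + 2)
          (relativeSingularHomology.map ℤ ℤ ((R.symm : ↥(halfBallOpens n) ≃ₜ ↥(halfBallOpens n)) :
            C(↥(halfBallOpens n), ↥(halfBallOpens n))) h₂ (n + 2) (γ.localClass (R v))) =
        relativeSingularHomology.map ℤ ℤ ((A : C(EuclideanSpace ℝ (Fin (n + 2)), EuclideanSpace ℝ (Fin (n + 2)))).comp
          (HomologicalOrientation.valC (halfBallOpens n))) (h₃.comp h₄) (n + 2) (γ.localClass (R v)) := by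
      rw [← ModuleCat.comp_apply, ← relativeSingularHomology.map_comp]
      exact congrArg (fun f : (localHomology ℤ ℤ ↥(halfBallOpens n) (R v) (n + 2) ⟶ _) => f _)
        (relativeSingularHomology.map_congr_left (R := ℤ) (M := ℤ) (ContinuousMap.ext fun w => rfl) _ _ (n + 2))
    have E2 : relativeSingularHomology.map ℤ ℤ ((A : C(EuclideanSpace ℝ (Fin (n + 2)), EuclideanSpace ℝ (Fin (n + 2)))).comp
          (HomologicalOrientation.valC (halfBallOpens n))) (h₃.comp h₄) (n + 2) (γ.localClass (R v)) =
        relativeSingularHomology.map ℤ ℤ (A : C(EuclideanSpace ℝ (Fin (n + 2)), EuclideanSpace ℝ (Fin (n + 2)))) h₃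
          (n + 2) (g.localClass ((R v : ↥(halfBallOpens n)) : EuclideanSpace ℝ (Fin (n + 2)))) := by
      rw [relativeSingularHomology.map_comp ℤ ℤ _ _ h₄ h₃, ModuleCat.comp_apply, hγ,
        HomologicalOrientation.map_val_restrictOpens_localClass]
    -- the affine/linear local degree: `det A < 0`
    have hc : Continuous fun w : EuclideanSpace ℝ (Fin (n + 2)) =>
        (v : EuclideanSpace ℝ (Fin (n + 2))) + A (w - (R v : ↥(halfBallOpens n))) :=
      continuous_const.add (A.continuous.comp (continuous_id.sub continuous_const))
    have hAff : (⟨fun w => (v : EuclideanSpace ℝ (Fin (n + 2))) + A (w - (R v : ↥(halfBallOpens n))), hc⟩ :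
        C(EuclideanSpace ℝ (Fin (n + 2)), EuclideanSpace ℝ (Fin (n + 2)))) =
        (A : C(EuclideanSpace ℝ (Fin (n + 2)), EuclideanSpace ℝ (Fin (n + 2)))) := by
      ext w : 1
      change (v : EuclideanSpace ℝ (Fin (n + 2))) + A (w - (R v : ↥(halfBallOpens n))) = A w
      rw [← hARv, ambReflectCLM_affine]
    have h₃' : MapsTo (fun w : EuclideanSpace ℝ (Fin (n + 2)) =>
        (v : EuclideanSpace ℝ (Fin (n + 2))) + A (w - (R v : ↥(halfBallOpens n))))
        ({((R v : ↥(halfBallOpens n)) : EuclideanSpace ℝ (Fin (n + 2)))}ᶜ) ({(v : EuclideanSpace ℝ (Fin (n + 2)))}ᶜ) := by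
      intro w hw
      have := h₃ hw
      change A w ∈ _ at this
      change (v : EuclideanSpace ℝ (Fin (n + 2))) + A (w - (R v : ↥(halfBallOpens n))) ∈ _
      rwa [← hARv, ambReflectCLM_affine, hARv]
    have E3 : relativeSingularHomology.map ℤ ℤ (A : C(EuclideanSpace ℝ (Fin (n + 2)), EuclideanSpace ℝ (Fin (n + 2)))) h₃
          (n + 2) (g.localClass ((R v : ↥(halfBallOpens n)) : EuclideanSpace ℝ (Fin (n + 2)))) =
        -g.localClass (v : EuclideanSpace ℝ (Fin (n + 2))) := by
      have := HomologicalOrientation.map_affine_localClass g A hdet.ne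
        ((R v : ↥(halfBallOpens n)) : EuclideanSpace ℝ (Fin (n + 2))) (v : EuclideanSpace ℝ (Fin (n + 2))) hc h₃'
      rw [if_neg (not_lt.2 hdet.le)] at this
      rw [← this]
      exact congrArg (fun f : (localHomology ℤ ℤ (EuclideanSpace ℝ (Fin (n + 2))) _ (n + 2) ⟶ _) => f _)
        (relativeSingularHomology.map_congr_left (R := ℤ) (M := ℤ) hAff.symm _ _ (n + 2))
    have E4 : -g.localClass (v : EuclideanSpace ℝ (Fin (n + 2))) =
        relativeSingularHomology.map ℤ ℤ (HomologicalOrientation.valC (halfBallOpens n)) h₁ (n + 2) (-γ.localClass v) := by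
      rw [map_neg, hγ, HomologicalOrientation.map_val_restrictOpens_localClass]
    rw [E0, E1, E2, E3, E4]
  -- the general orientation is `±γ`
  rcases HomologicalOrientation.eq_or_eq_neg_of_connected_holds (↥(halfBallOpens n)) μ γ with h | h
  · rw [h]; exact key v
  · rw [h, HomologicalOrientation.comap_neg, HomologicalOrientation.neg_localClass,
      HomologicalOrientation.neg_localClass, key v]

/-- **The sign flip.**  If an orientation `b_S` of the half-ball equals `ε₁` times `b_T`
transported along the inversion, and also `ε₂` times the REFLECTED `b_T` transported along the
inversion, then `ε₂ = -ε₁` (the reflection commutes with the inversion and reverses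
orientations). [cite: KervaireMilnorAnnals1963, §2 pp. 507–508] -/
theorem units_eq_neg_of_halfBall {bS bT : HomologicalOrientation ℤ ↥(halfBallOpens n) (n + 2)} {ε₁ ε₂ : ℤˣ}
    (h₁ : ∀ v, bS.localClass v = (ε₁ : ℤ) • (bT.comap (halfBallInversion n)).localClass v)
    (h₂ : ∀ v, bS.localClass v =
      (ε₂ : ℤ) • ((bT.comap (halfBallReflect n)).comap (halfBallInversion n)).localClass v) :
    ε₂ = -ε₁ := by
  obtain ⟨v⟩ := (inferInstance : Nonempty ↥(halfBallOpens n))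
  have hcomm : (halfBallInversion n).trans (halfBallReflect n) = (halfBallReflect n).trans (halfBallInversion n) := by
    ext w : 1
    exact halfBallReflect_halfBallInversion w
  have e : ((bT.comap (halfBallReflect n)).comap (halfBallInversion n)).localClass v =
      -(bT.comap (halfBallInversion n)).localClass v := by
    rw [HomologicalOrientation.comap_comap_localClass, hcomm, ← HomologicalOrientation.comap_comap_localClass,
      comap_halfBallReflect_localClass]
  have h := (h₁ v).symm.trans (h₂ v)
  rw [e, zsmul_neg, ← neg_zsmul] at h
  obtain ⟨φ, hφ⟩ := (bT.comap (halfBallInversion n)).isGenerator v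
  have h' := congrArg φ h
  rw [map_zsmul, map_zsmul, hφ, smul_eq_mul, mul_one, smul_eq_mul, mul_one] at h'
  exact Units.ext (by rw [Units.val_neg]; omega)

end ReflectReverses


/-! ### O5. The boundary orientation of the glued class on a linked piece -/

namespace NullCobordism.Piece

variable {m : ℕ}
variable {MP : Type} [TopologicalSpace MP] [ChartedSpace (EuclideanSpace ℝ (Fin (m + 1))) MP]
  [IsManifold (𝓡 (m + 1)) ∞ MP] [CompactSpace MP] [T2Space MP]
variable {MU : Type} [TopologicalSpace MU] [ChartedSpace (EuclideanSpace ℝ (Fin (m + 1))) MU]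
  [IsManifold (𝓡 (m + 1)) ∞ MU] [CompactSpace MU] [T2Space MU]
variable {cP : NullCobordism (m + 1) MP} {cU : NullCobordism (m + 1) MU} {P : Piece cP cU}

/-- The sphere-level gluing map of a boundary link, as a continuous map. [folklore] -/
def BdryLink.jC (L : P.BdryLink) : C(L.A', MU) := ⟨L.j', L.contMDiff.continuous⟩

/-- The boundary inclusion of the sphere-level piece, `s ↦ incl_P s ∈ ∂W_P`. [folklore] -/
def BdryLink.inclB (L : P.BdryLink) : C(L.A', ↥((𝓡∂ (m + 1 + 1)).boundary cP.W)) :=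
  ⟨fun s => ⟨cP.incl s, cP.incl_mem_boundary s⟩,
    ((cP.continuous_incl.comp continuous_subtype_val).subtype_mk _)⟩

omit [IsManifold (𝓡 (m + 1)) ∞ MP] [CompactSpace MP] [T2Space MP] [IsManifold (𝓡 (m + 1)) ∞ MU] [CompactSpace MU] [T2Space MU] in
/-- `inclB` is an open embedding (it is `e_P ∘ val`). [folklore] -/
theorem BdryLink.isOpenEmbedding_inclB (L : P.BdryLink) : IsOpenEmbedding L.inclB := by
  have h : (L.inclB : L.A' → _) = cP.bdryHomeomorph ∘ (Subtype.val : L.A' → MP) := by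
    funext s
    apply Subtype.ext
    change cP.incl s = (cP.bdryHomeomorph (s : MP) : cP.W)
    rw [NullCobordism.coe_bdryHomeomorph]
  rw [h]
  exact cP.bdryHomeomorph.isOpenEmbedding.comp (HomologicalOrientation.isOpenEmbedding_valC L.A')

/-- **The boundary orientation of a relative fundamental class, restricted to a linked piece of
the boundary**: the boundary orientation `∂w` of `(W_P, w)`, pulled back to the open piece `A'`
of `M_P` along `s ↦ incl_P s`. [folklore] -/
def BdryLink.linkOrientation (L : P.BdryLink)
    {w : relativeSingularHomology ℤ ℤ cP.W ((𝓡∂ (m + 1 + 1)).boundary cP.W) (m + 1 + 1)}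
    (hw : IsRelFundamentalClass ℤ ((𝓡∂ (m + 1 + 1)).boundary cP.W) w) :
    HomologicalOrientation ℤ L.A' (m + 1) :=
  (boundaryOrientation ℤ m.succ_ne_zero hw).pullback L.inclB L.isOpenEmbedding_inclB

omit [IsManifold (𝓡 (m + 1)) ∞ MP] [CompactSpace MP] [T2Space MP] [IsManifold (𝓡 (m + 1)) ∞ MU] [CompactSpace MU] [T2Space MU] in
/-- Defining property of the link orientation. [folklore] -/
theorem BdryLink.map_inclB_linkOrientation_localClass (L : P.BdryLink)
    {w : relativeSingularHomology ℤ ℤ cP.W ((𝓡∂ (m + 1 + 1)).boundary cP.W) (m + 1 + 1)}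
    (hw : IsRelFundamentalClass ℤ ((𝓡∂ (m + 1 + 1)).boundary cP.W) w) (s : L.A') :
    relativeSingularHomology.map ℤ ℤ L.inclB (LocalFamily.mapsTo_compl_pt L.isOpenEmbedding_inclB.injective s)
      (m + 1) ((L.linkOrientation hw).localClass s) =
      (boundaryOrientation ℤ m.succ_ne_zero hw).localClass (L.inclB s) :=
  HomologicalOrientation.map_pullback_localClass _ L.inclB L.isOpenEmbedding_inclB s

omit [IsManifold (𝓡 (m + 1)) ∞ MP] [CompactSpace MP] [T2Space MP] [IsManifold (𝓡 (m + 1)) ∞ MU] [CompactSpace MU] [T2Space MU] in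
/-- `e_U ∘ j'` is a map of pairs at `s`. [folklore] -/
theorem BdryLink.mapsTo_jC (L : P.BdryLink) (s : L.A') :
    MapsTo ((cU.bdryHomeomorph : C(MU, ↥((𝓡∂ (m + 1 + 1)).boundary cU.W))).comp L.jC)
      ({s}ᶜ : Set L.A') ({L.bpt s}ᶜ : Set _) := by
  intro s' hs' h
  apply hs'
  rw [mem_singleton_iff] at h ⊢
  have h' : (cU.bdryHomeomorph (L.j' s') : cU.W) = (L.bpt s : cU.W) := congrArg Subtype.val h
  rw [NullCobordism.coe_bdryHomeomorph, L.sq s'] at h'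
  change P.j (L.pt s') = P.j (L.pt s) at h'
  have h'' := P.j_injective h'
  have h3 : cP.incl (s' : MP) = cP.incl s := congrArg (fun z : P.A => (z : cP.W)) h''
  exact Subtype.ext (cP.injective_incl h3)

omit [IsManifold (𝓡 (m + 1)) ∞ MP] [CompactSpace MP] [T2Space MP] [IsManifold (𝓡 (m + 1)) ∞ MU] [CompactSpace MU] [T2Space MU] in
/-- **The boundary orientation of the glued class, computed on a linked piece** (homological
form of Kervaire–Milnor 1963, §2, "`bW = bW₁ # bW₂` as oriented manifolds"; Hatcher 2002,
p. 253; locality of the boundary class, `toLocal_δ_eq_of_two_embeddings_manifold`).  Let `w` be a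
relative fundamental class of `W_P`, `w_U` one of `W_U`, and suppose the local classes of `w_U`
on the piece are `u · j_* (w|)` (`u = ±1`, the output of `BCSGluing.exists_isRelFundamentalClass`).
Then at the boundary point of `W_U` attached to `s ∈ A'`, the boundary orientation `∂w_U` has
local class `u` times the push-forward along `e_U ∘ j'` of the link orientation (`∂w` read on
`A'`). [cite: KervaireMilnorAnnals1963, §2 pp. 507–508] -/
theorem boundaryOrientation_localClass_eq_smul_linkOrientation (L : P.BdryLink)
    {w : relativeSingularHomology ℤ ℤ cP.W ((𝓡∂ (m + 1 + 1)).boundary cP.W) (m + 1 + 1)}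
    (hw : IsRelFundamentalClass ℤ ((𝓡∂ (m + 1 + 1)).boundary cP.W) w)
    {wU : relativeSingularHomology ℤ ℤ cU.W ((𝓡∂ (m + 1 + 1)).boundary cU.W) (m + 1 + 1)}
    (hwU : IsRelFundamentalClass ℤ ((𝓡∂ (m + 1 + 1)).boundary cU.W) wU) (u : ℤˣ)
    (hrel : ∀ (x : P.A) (hx : (x : cP.W) ∈ ((𝓡∂ (m + 1 + 1)).boundary cP.W)ᶜ),
      relativeSingularHomology.toLocal ℤ ℤ _ ⟨P.j x, P.j_mem_compl_boundary hx⟩ (m + 1 + 1) wU =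
        (u : ℤ) • relativeSingularHomology.map ℤ ℤ P.j (LocalFamily.mapsTo_compl_pt P.j_injective x)
          (m + 1 + 1) (P.pieceClass w x))
    (s : L.A') :
    (boundaryOrientation ℤ m.succ_ne_zero hwU).localClass (L.bpt s) =
      (u : ℤ) • relativeSingularHomology.map ℤ ℤ
        ((cU.bdryHomeomorph : C(MU, ↥((𝓡∂ (m + 1 + 1)).boundary cU.W))).comp L.jC) (L.mapsTo_jC s) (m + 1)
        ((L.linkOrientation hw).localClass s) := by
  classical
  set eP := cP.bdryHomeomorph with heP
  set eU := cU.bdryHomeomorph with heU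
  set b : P.A := L.pt s with hb
  have hbP : (b : cP.W) ∈ (𝓡∂ (m + 1 + 1)).boundary cP.W := L.pt_mem_boundary s
  haveI : Nonempty P.A := ⟨b⟩
  have hB₁ : ∀ x' : P.A, x' ∈ (𝓡∂ (m + 1 + 1)).boundary P.A ↔
      (P.ι x' : cP.W) ∈ (𝓡∂ (m + 1 + 1)).boundary cP.W := fun x' => mem_boundary_opens_iff P.A x'
  have hB₂ : ∀ x' : P.A, x' ∈ (𝓡∂ (m + 1 + 1)).boundary P.A ↔
      P.j x' ∈ (𝓡∂ (m + 1 + 1)).boundary cU.W := fun x' => (hB₁ x').trans (P.mem_boundary_iff x')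
  have hbW' : b ∈ (𝓡∂ (m + 1 + 1)).boundary P.A := (hB₁ b).2 hbP
  -- (1) locality of the boundary class for the two embeddings `ι`, `j` of the piece
  obtain ⟨β, hβ₁, hβ₂⟩ := toLocal_δ_eq_of_two_embeddings_manifold ℤ ℤ (W' := P.A) hbW'
    P.isOpenEmbedding_ι P.isOpenEmbedding_j hB₁ hB₂ ((u : ℤ) • w) wU (by
      intro h c'
      have hcW' : (c'.center : cP.W) ∈ ((𝓡∂ (m + 1 + 1)).boundary cP.W)ᶜ :=
        fun hc => c'.center_not_mem_B ((hB₁ _).2 hc)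
      refine ⟨(u : ℤ) • P.pieceClass w c'.center, ?_, ?_⟩
      · rw [map_zsmul, map_zsmul]
        congr 1
        exact (P.map_ι_pieceClass_of_mem w c'.center hcW').symm
      · rw [map_zsmul]
        exact hrel c'.center hcW')
  -- (2) the `W_P`-side: `(∂(u w))|_b = u • (∂w)|_{e_P s}`
  have hside : singularHomology.toLocal ℤ ℤ (⟨P.ι b, (hB₁ b).1 hbW'⟩ :
      ↥((𝓡∂ (m + 1 + 1)).boundary cP.W)) (m + 1)
        (relativeSingularHomology.δ ℤ ℤ cP.W _ (m + 1) ((u : ℤ) • w)) =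
      (u : ℤ) • (boundaryOrientation ℤ m.succ_ne_zero hw).localClass (⟨P.ι b, (hB₁ b).1 hbW'⟩ :
      ↥((𝓡∂ (m + 1 + 1)).boundary cP.W)) := by
    rw [map_zsmul, map_zsmul, boundaryOrientation_localClass]
  -- (3) the sphere-level piece `A'` and its maps `κ' : A' → ∂W'`, `val'`, `j'`
  let κ' : C(L.A', ↥((𝓡∂ (m + 1 + 1)).boundary P.A)) :=
    ⟨fun s' => ⟨L.pt s', (hB₁ _).2 (L.pt_mem_boundary s')⟩,
      ((cP.continuous_incl.comp continuous_subtype_val).subtype_mk _).subtype_mk _⟩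
  have hκ'inj : Injective κ' := fun a a' h => by
    have h1 : cP.incl a = cP.incl a' := congrArg (fun z : ↥((𝓡∂ (m + 1 + 1)).boundary P.A) =>
      ((z : P.A) : cP.W)) h
    exact Subtype.ext (cP.injective_incl h1)
  have R1 : (bdryRestrict P.isOpenEmbedding_ι.continuous hB₁).comp κ' = L.inclB := by
    ext s' : 2; rfl
  have R2 : (bdryRestrict P.isOpenEmbedding_j.continuous hB₂).comp κ' =
      (eU : C(MU, _)).comp L.jC := by
    ext s' : 2
    exact (L.sq s').symm
  -- (4) identify `β = u • κ'_* (linkOrientation)_s`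
  have mκ' : MapsTo κ' ({s}ᶜ : Set L.A') ({(⟨b, hbW'⟩ : ↥((𝓡∂ (m + 1 + 1)).boundary P.A))}ᶜ : Set _) :=
    LocalFamily.mapsTo_compl_pt hκ'inj s
  have mres₁ := mapsTo_bdryRestrict P.isOpenEmbedding_ι.continuous P.isOpenEmbedding_ι.injective
    hB₁ hbW'
  have hβ : β = (u : ℤ) • relativeSingularHomology.map ℤ ℤ κ' mκ' (m + 1) ((L.linkOrientation hw).localClass s) := by
    haveI : IsIso (relativeSingularHomology.map ℤ ℤ
        (bdryRestrict P.isOpenEmbedding_ι.continuous hB₁) mres₁ (m + 1)) :=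
      localHomology.isIso_map_of_isOpenEmbedding_of_eq ℤ ℤ
        (bdryRestrict P.isOpenEmbedding_ι.continuous hB₁)
        (isOpenEmbedding_bdryRestrict P.isOpenEmbedding_ι hB₁) ⟨b, hbW'⟩ rfl (m + 1)
    apply (ModuleCat.mono_iff_injective (relativeSingularHomology.map ℤ ℤ
      (bdryRestrict P.isOpenEmbedding_ι.continuous hB₁) mres₁ (m + 1))).1 inferInstance
    have h₁ : MapsTo ((bdryRestrict P.isOpenEmbedding_ι.continuous hB₁).comp κ') ({s}ᶜ : Set L.A')
        ({(⟨P.ι b, (hB₁ b).1 hbW'⟩ : ↥((𝓡∂ (m + 1 + 1)).boundary cP.W))}ᶜ : Set _) :=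
      mres₁.comp mκ'
    have h₁' : MapsTo L.inclB ({s}ᶜ : Set L.A')
        ({(⟨P.ι b, (hB₁ b).1 hbW'⟩ : ↥((𝓡∂ (m + 1 + 1)).boundary cP.W))}ᶜ : Set _) :=
      LocalFamily.mapsTo_compl_pt L.isOpenEmbedding_inclB.injective s
    rw [← hβ₁, hside, map_zsmul, ← ModuleCat.comp_apply,
      ← relativeSingularHomology.map_comp ℤ ℤ κ' _ mκ' mres₁ (m + 1),
      relativeSingularHomology.map_congr_fun' R1 h₁ h₁' (m + 1)]
    congr 1
    exact (L.map_inclB_linkOrientation_localClass hw s).symm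
  -- (5) the `W_U`-side
  have mres₂ := mapsTo_bdryRestrict P.isOpenEmbedding_j.continuous P.isOpenEmbedding_j.injective
    hB₂ hbW'
  have h₂ : MapsTo ((bdryRestrict P.isOpenEmbedding_j.continuous hB₂).comp κ') ({s}ᶜ : Set L.A')
      ({L.bpt s}ᶜ : Set _) := mres₂.comp mκ'
  rw [boundaryOrientation_localClass]
  change singularHomology.toLocal ℤ ℤ (⟨P.j b, (hB₂ b).1 hbW'⟩ : ↥((𝓡∂ (m + 1 + 1)).boundary cU.W))
    (m + 1) (relativeSingularHomology.δ ℤ ℤ cU.W _ (m + 1) wU) = _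
  rw [hβ₂, hβ, map_zsmul, ← ModuleCat.comp_apply,
    ← relativeSingularHomology.map_comp ℤ ℤ κ' _ mκ' mres₂ (m + 1),
    relativeSingularHomology.map_congr_fun' R2 h₂ (L.mapsTo_jC s) (m + 1)]

end NullCobordism.Piece


/-! ### O6a. The cylinder over a connected closed oriented manifold as an oriented null-cobordism of the double -/

section CylinderNull

variable {n : ℕ} {A : Type} [TopologicalSpace A] [T2Space A] [SecondCountableTopology A]
  [ChartedSpace (EuclideanSpace ℝ (Fin (n + 1))) A] [IsManifold (𝓡 (n + 1)) ∞ A] [CompactSpace A]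

/-- The cylinder `A × [0, 1]` as a null-cobordism of the double `A ⊔ A` (bottom `inl`, top `inr`).
[cite: MilnorHCobordism1965, §1] -/
def cylinderNull (n : ℕ) (A : Type) [TopologicalSpace A] [T2Space A] [SecondCountableTopology A]
    [ChartedSpace (EuclideanSpace ℝ (Fin (n + 1))) A] [IsManifold (𝓡 (n + 1)) ∞ A] [CompactSpace A] :
    NullCobordism (n + 1) (A ⊕ A) :=
  letI : ChartedSpace (EuclideanSpace ℝ (Fin (n + 1))) PEmpty.{1} := ChartedSpace.empty _ _
  NullCobordism.ofCobordism (N := PEmpty.{1})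
    { W := (cylinderCobordism (n + 1) A).W
      inl := Sum.elim (cylinderCobordism (n + 1) A).inl (cylinderCobordism (n + 1) A).inr
      inr := fun e => isEmptyElim e
      isSmoothEmbedding_inl := isSmoothEmbedding_sumElim (cylinderCobordism (n + 1) A).isSmoothEmbedding_inl
        (cylinderCobordism (n + 1) A).isSmoothEmbedding_inr (cylinderCobordism (n + 1) A).disjoint_range
      isSmoothEmbedding_inr := NullCobordism.isSmoothEmbedding_of_isEmpty _
      disjoint_range := by
        rw [range_eq_empty fun e : PEmpty.{1} => (isEmptyElim e : (cylinderCobordism (n + 1) A).W)]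
        exact disjoint_empty _
      range_inl_union_range_inr := by
        rw [range_eq_empty fun e : PEmpty.{1} => (isEmptyElim e : (cylinderCobordism (n + 1) A).W), union_empty,
          Set.Sum.elim_range, (cylinderCobordism (n + 1) A).range_inl_union_range_inr] }

/-- The total space of `cylinderNull` is the cylinder. [folklore] -/
theorem cylinderNull_W : (cylinderNull n A).W = ↥(Cylinder.carrier A) := rfl

/-- The boundary inclusion of `cylinderNull` on the bottom copy. [folklore] -/
theorem cylinderNull_incl_inl (a : A) : (cylinderNull n A).incl (Sum.inl a) = (cylinderCobordism (n + 1) A).inl a := rfl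

/-- The total space of the cylinder null-cobordism is connected when `A` is. [folklore] -/
instance connectedSpace_cylinderNull_W [ConnectedSpace A] : ConnectedSpace (cylinderNull n A).W :=
  Cylinder.connectedSpace_carrier

/-- The bottom inclusion `a ↦ incl (inl a) ∈ ∂(A × I)` as a continuous map into the boundary. [folklore] -/
def cylinderNullBottom (n : ℕ) (A : Type) [TopologicalSpace A] [T2Space A] [SecondCountableTopology A]
    [ChartedSpace (EuclideanSpace ℝ (Fin (n + 1))) A] [IsManifold (𝓡 (n + 1)) ∞ A] [CompactSpace A] :
    C(A, ↥((𝓡∂ (n + 1 + 1)).boundary (cylinderNull n A).W)) :=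
  (cylinderCobordism (n + 1) A).inlBoundary

/-- The bottom inclusion is `incl ∘ inl`. [folklore] -/
theorem coe_cylinderNullBottom (a : A) :
    (cylinderNullBottom n A a : (cylinderNull n A).W) = (cylinderNull n A).incl (Sum.inl a) := rfl

/-- The bottom inclusion is injective. [folklore] -/
theorem cylinderNullBottom_injective : Injective (cylinderNullBottom n A) := fun _ _ h =>
  (cylinderCobordism (n + 1) A).isSmoothEmbedding_inl.isEmbedding.injective (congrArg Subtype.val h)

/-- **The cylinder over a closed connected oriented manifold is an oriented null-cobordism of the
double, and its boundary orientation on the bottom copy is the given orientation**: there is a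
relative fundamental class `w` of `(A × I, ∂)` whose boundary orientation at `incl (inl a)` is
`(i₀)_* α_a` (Milnor–Stasheff 1974, Lemma 17.1: `M + (−M) = ∂(M × [0,1])`; the class comes from
exactness, `isOrientedBordant_refl`, and is a relative fundamental class because the cylinder is
connected, `Cobordism.isRelFundamentalClass_of_δ_eq`). [cite: MilnorStasheffAMS76, Lemma 17.1] -/
theorem exists_isRelFundamentalClass_cylinderNull [ConnectedSpace A] [Nonempty A]
    (α : HomologicalOrientation ℤ A (n + 1)) :
    ∃ (w : relativeSingularHomology ℤ ℤ (cylinderNull n A).W ((𝓡∂ (n + 1 + 1)).boundary (cylinderNull n A).W) (n + 1 + 1))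
      (hw : IsRelFundamentalClass ℤ ((𝓡∂ (n + 1 + 1)).boundary (cylinderNull n A).W) w),
      ∀ a : A, (boundaryOrientation ℤ n.succ_ne_zero hw).localClass (cylinderNullBottom n A a) =
        relativeSingularHomology.map ℤ ℤ (cylinderNullBottom n A)
          (LocalFamily.mapsTo_compl_pt cylinderNullBottom_injective a) (n + 1) (α.localClass a) := by
  set c : Cobordism (n + 1) A A := cylinderCobordism (n + 1) A with hc
  -- the class from exactness (as in `isOrientedBordant_refl`)
  set ι : C(↥((𝓡∂ (n + 1 + 1)).boundary c.W), c.W) := ⟨Subtype.val, continuous_subtype_val⟩ with hι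
  have h0 : ι.comp c.inlBoundary = ⟨c.inl, c.continuous_inl⟩ := ContinuousMap.ext fun _ => rfl
  have h1 : ι.comp c.inrBoundary = ⟨c.inr, c.continuous_inr⟩ := ContinuousMap.ext fun _ => rfl
  have hker : singularHomology.map ℤ ℤ ι (n + 1)
      (singularHomology.map ℤ ℤ c.inlBoundary (n + 1) α.fundamentalClass -
        singularHomology.map ℤ ℤ c.inrBoundary (n + 1) α.fundamentalClass) = 0 := by
    rw [map_sub, ← ModuleCat.comp_apply, ← singularHomology.map_comp, h0, ← ModuleCat.comp_apply,
      ← singularHomology.map_comp, h1,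
      singularHomology.map_eq_of_homotopic ℤ ℤ (Cylinder.homotopic_inl_inr (n := n + 1) (M := A)) (n + 1),
      sub_self]
  obtain ⟨w, hw⟩ := (CategoryTheory.ShortComplex.moduleCat_exact_iff _).1
    (relativeSingularHomology.exact_δ_map ℤ ℤ ((𝓡∂ (n + 1 + 1)).boundary c.W) (n + 1)) _ hker
  haveI : ConnectedSpace c.W := Cylinder.connectedSpace_carrier
  have hwrel : IsRelFundamentalClass ℤ ((𝓡∂ (n + 1 + 1)).boundary c.W) w :=
    c.isRelFundamentalClass_of_δ_eq α α hw
  refine ⟨w, hwrel, fun a => ?_⟩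
  rw [boundaryOrientation_localClass]
  change singularHomology.toLocal ℤ ℤ (c.inlBoundary a) (n + 1)
    (relativeSingularHomology.δ ℤ ℤ c.W ((𝓡∂ (n + 1 + 1)).boundary c.W) (n + 1) w) = _
  rw [hw, map_sub,
    singularHomology.toLocal_map_apply ℤ ℤ c.inlBoundary a (c.inlBoundary a)
      (LocalFamily.mapsTo_compl_pt cylinderNullBottom_injective a) (n + 1),
    singularHomology.toLocal_map_eq_zero_of_forall_ne ℤ ℤ c.inrBoundary (c.inlBoundary a)
      (fun a' h => (c.toBoundarySplitting.iNB_ne_iMB a a') h) (n + 1), sub_zero,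
    HomologicalOrientation.isFundamentalClass_fundamentalClass_holds (R := ℤ) (X := A) (n + 1) α a]
  rfl

end CylinderNull

/-! ### O6b. The boundary connected sum of two null-cobordisms at prescribed discs, packaged -/

namespace NullCobordism

variable {n : ℕ} {MS MT : Type}
  [TopologicalSpace MS] [ChartedSpace (EuclideanSpace ℝ (Fin (n + 1))) MS] [IsManifold (𝓡 (n + 1)) ∞ MS]
  [CompactSpace MS] [T2Space MS] [Nonempty MS] [SecondCountableTopology MS]
  [TopologicalSpace MT] [ChartedSpace (EuclideanSpace ℝ (Fin (n + 1))) MT] [IsManifold (𝓡 (n + 1)) ∞ MT]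
  [CompactSpace MT] [T2Space MT] [Nonempty MT] [SecondCountableTopology MT]

omit [CompactSpace MS] [T2Space MS] [Nonempty MS] [SecondCountableTopology MS] [CompactSpace MT] [T2Space MT] [Nonempty MT] [SecondCountableTopology MT] in
/-- The existence statement behind `bcsSetupOf`: a compact glued manifold `W_S ♮ W_T` along the
collar half-discs over the discs of `Dσ`, with its half gluing. [cite: Juhasz2023, Def. 1.47] -/
theorem exists_halfGluing (cS : NullCobordism (n + 1) MS) (cT : NullCobordism (n + 1) MT)
    (κS : cS.boundaryData.Collar) (κT : cT.boundaryData.Collar) (Dσ : ConnectedSumData (n + 1) MS MT) :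
    ∃ (P : Type) (_ : TopologicalSpace P) (_ : T2Space P) (_ : SecondCountableTopology P)
      (_ : ChartedSpace (EuclideanHalfSpace (n + 2)) P) (_ : IsManifold (𝓡∂ (n + 2)) ∞ P) (_ : CompactSpace P),
      Nonempty (HalfGluing (κS.halfDisc Dσ.i₁) (κT.halfDisc Dσ.i₂) P) := by
  have hkS := κS.isSmoothEmbedding_halfDisc Dσ.isSmoothEmbedding_i₁
    (isOpen_range_of_isSmoothEmbedding_disc Dσ.isSmoothEmbedding_i₁)
  have hkT := κT.isSmoothEmbedding_halfDisc Dσ.isSmoothEmbedding_i₂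
    (isOpen_range_of_isSmoothEmbedding_disc Dσ.isSmoothEmbedding_i₂)
  obtain ⟨P, _, _, _, _, _, hglue⟩ :=
    (HalfDiscPair.mk (κS.halfDisc Dσ.i₁) (κT.halfDisc Dσ.i₂) hkS.1 hkS.2 hkT.1 hkT.2).exists_isOpenGluing
  haveI : CompactSpace P := compactSpace_of_isOpenGluing_boundaryConnectedSumRel_holds (n + 2) cS.W
    cT.W P _ _ hkS.1 hkS.2 hkT.1 hkT.2 hglue
  exact ⟨P, inferInstance, inferInstance, inferInstance, inferInstance, inferInstance, inferInstance,
    HalfGluing.nonempty_of_isOpenGluing hglue⟩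

/-- **The boundary connected sum setup of two null-cobordisms at prescribed discs**, with the
glued connected sum `M_S # M_T` itself as boundary manifold (chosen glued space).
[cite: KervaireMilnorAnnals1963, §2 p. 508] -/
def bcsSetupOf (cS : NullCobordism (n + 1) MS) (cT : NullCobordism (n + 1) MT)
    (κS : cS.boundaryData.Collar) (κT : cT.boundaryData.Collar) (Dσ : ConnectedSumData (n + 1) MS MT) :
    BCSSetup n :=
  letI h := exists_halfGluing cS cT κS κT Dσ
  letI P := h.choose
  letI i1 := h.choose_spec.choose
  letI i2 := h.choose_spec.choose_spec.choose
  letI i3 := h.choose_spec.choose_spec.choose_spec.choose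
  letI i4 := h.choose_spec.choose_spec.choose_spec.choose_spec.choose
  letI i5 := h.choose_spec.choose_spec.choose_spec.choose_spec.choose_spec.choose
  letI i6 := h.choose_spec.choose_spec.choose_spec.choose_spec.choose_spec.choose_spec.choose
  letI W := Classical.choice h.choose_spec.choose_spec.choose_spec.choose_spec.choose_spec.choose_spec.choose_spec
  { MS := MS
    MT := MT
    MU := Dσ.Glued (Nat.succ_ne_zero n)
    cS := cS
    cT := cT
    κS := κS
    κT := κT
    iS := Dσ.i₁
    iT := Dσ.i₂
    hiS := Dσ.isSmoothEmbedding_i₁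
    hiT := Dσ.isSmoothEmbedding_i₂
    P := P
    topP := i1
    t2P := i2
    secondP := i3
    chartP := i4
    manifoldP := i5
    compactP := i6
    W := W
    Dσ := Dσ
    hD₁ := rfl
    hD₂ := rfl
    jA := (Dσ.glueData (Nat.succ_ne_zero n)).inl
    jB := (Dσ.glueData (Nat.succ_ne_zero n)).inr
    hjA := (Dσ.glueData (Nat.succ_ne_zero n)).isSmoothEmbedding_inl
    hjAo := (Dσ.glueData (Nat.succ_ne_zero n)).isOpen_range_inl
    hjB := (Dσ.glueData (Nat.succ_ne_zero n)).isSmoothEmbedding_inr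
    hjBo := (Dσ.glueData (Nat.succ_ne_zero n)).isOpen_range_inr
    Ψ := Diffeomorph.refl _ _ _
    hΨA := fun _ => rfl
    hΨB := fun _ => rfl }

omit [SecondCountableTopology MS] [SecondCountableTopology MT] in
/-- Unfolding. [folklore] -/
@[simp] theorem bcsSetupOf_cS (cS : NullCobordism (n + 1) MS) (cT : NullCobordism (n + 1) MT)
    (κS : cS.boundaryData.Collar) (κT : cT.boundaryData.Collar) (Dσ : ConnectedSumData (n + 1) MS MT) :
    (bcsSetupOf cS cT κS κT Dσ).cS = cS := rfl

omit [SecondCountableTopology MS] [SecondCountableTopology MT] in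
/-- Unfolding. [folklore] -/
@[simp] theorem bcsSetupOf_cT (cS : NullCobordism (n + 1) MS) (cT : NullCobordism (n + 1) MT)
    (κS : cS.boundaryData.Collar) (κT : cT.boundaryData.Collar) (Dσ : ConnectedSumData (n + 1) MS MT) :
    (bcsSetupOf cS cT κS κT Dσ).cT = cT := rfl

omit [SecondCountableTopology MS] [SecondCountableTopology MT] in
/-- Unfolding. [folklore] -/
@[simp] theorem bcsSetupOf_MU (cS : NullCobordism (n + 1) MS) (cT : NullCobordism (n + 1) MT)
    (κS : cS.boundaryData.Collar) (κT : cT.boundaryData.Collar) (Dσ : ConnectedSumData (n + 1) MS MT) :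
    (bcsSetupOf cS cT κS κT Dσ).MU = Dσ.Glued (Nat.succ_ne_zero n) := rfl

omit [SecondCountableTopology MS] [SecondCountableTopology MT] in
/-- Unfolding. [folklore] -/
@[simp] theorem bcsSetupOf_jA (cS : NullCobordism (n + 1) MS) (cT : NullCobordism (n + 1) MT)
    (κS : cS.boundaryData.Collar) (κT : cT.boundaryData.Collar) (Dσ : ConnectedSumData (n + 1) MS MT) :
    (bcsSetupOf cS cT κS κT Dσ).jA = (Dσ.glueData (Nat.succ_ne_zero n)).inl := rfl

omit [SecondCountableTopology MS] [SecondCountableTopology MT] in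
/-- Unfolding. [folklore] -/
@[simp] theorem bcsSetupOf_jB (cS : NullCobordism (n + 1) MS) (cT : NullCobordism (n + 1) MT)
    (κS : cS.boundaryData.Collar) (κT : cT.boundaryData.Collar) (Dσ : ConnectedSumData (n + 1) MS MT) :
    (bcsSetupOf cS cT κS κT Dσ).jB = (Dσ.glueData (Nat.succ_ne_zero n)).inr := rfl

end NullCobordism


/-! ### O6c. Transport lemmas: boundary orientation along a linked family of points; pull-backs of transports -/

namespace NullCobordism.Piece

variable {m : ℕ}
variable {MP : Type} [TopologicalSpace MP] [ChartedSpace (EuclideanSpace ℝ (Fin (m + 1))) MP]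
  [IsManifold (𝓡 (m + 1)) ∞ MP] [CompactSpace MP] [T2Space MP]
variable {MU : Type} [TopologicalSpace MU] [ChartedSpace (EuclideanSpace ℝ (Fin (m + 1))) MU]
  [IsManifold (𝓡 (m + 1)) ∞ MU] [CompactSpace MU] [T2Space MU]
variable {cP : NullCobordism (m + 1) MP} {cU : NullCobordism (m + 1) MU} {P : Piece cP cU}

omit [IsManifold (𝓡 (m + 1)) ∞ MP] [CompactSpace MP] [T2Space MP] [IsManifold (𝓡 (m + 1)) ∞ MU] [CompactSpace MU] [T2Space MU] in
/-- **The boundary orientation of the glued class along a family of linked points.**  If an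
orientation `ζ` of `Z` is carried by `incl_P ∘ g` to the boundary orientation `∂w` of `W_P`
(`g : Z → A'`), then `∂w_U` at the attached points `bpt (g z)` is `u` times `ζ` carried by
`e_U ∘ j' ∘ g`. [cite: KervaireMilnorAnnals1963, §2 pp. 507–508] -/
theorem boundaryOrientation_localClass_bpt_eq_smul_map {Z : Type} [TopologicalSpace Z] (L : P.BdryLink)
    {w : relativeSingularHomology ℤ ℤ cP.W ((𝓡∂ (m + 1 + 1)).boundary cP.W) (m + 1 + 1)}
    (hw : IsRelFundamentalClass ℤ ((𝓡∂ (m + 1 + 1)).boundary cP.W) w)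
    {wU : relativeSingularHomology ℤ ℤ cU.W ((𝓡∂ (m + 1 + 1)).boundary cU.W) (m + 1 + 1)}
    (hwU : IsRelFundamentalClass ℤ ((𝓡∂ (m + 1 + 1)).boundary cU.W) wU) (u : ℤˣ)
    (hrel : ∀ (x : P.A) (hx : (x : cP.W) ∈ ((𝓡∂ (m + 1 + 1)).boundary cP.W)ᶜ),
      relativeSingularHomology.toLocal ℤ ℤ _ ⟨P.j x, P.j_mem_compl_boundary hx⟩ (m + 1 + 1) wU =
        (u : ℤ) • relativeSingularHomology.map ℤ ℤ P.j (LocalFamily.mapsTo_compl_pt P.j_injective x)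
          (m + 1 + 1) (P.pieceClass w x))
    (g : C(Z, L.A')) (hg : Injective g) (ζ : HomologicalOrientation ℤ Z (m + 1))
    (hζ : ∀ z, (boundaryOrientation ℤ m.succ_ne_zero hw).localClass (L.inclB (g z)) =
      relativeSingularHomology.map ℤ ℤ (L.inclB.comp g)
        (LocalFamily.mapsTo_compl_pt (L.isOpenEmbedding_inclB.injective.comp hg) z) (m + 1) (ζ.localClass z))
    (z : Z) :
    (boundaryOrientation ℤ m.succ_ne_zero hwU).localClass (L.bpt (g z)) =
      (u : ℤ) • relativeSingularHomology.map ℤ ℤ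
        (((cU.bdryHomeomorph : C(MU, ↥((𝓡∂ (m + 1 + 1)).boundary cU.W))).comp L.jC).comp g)
        ((L.mapsTo_jC (g z)).comp (LocalFamily.mapsTo_compl_pt hg z)) (m + 1) (ζ.localClass z) := by
  have hO := P.boundaryOrientation_localClass_eq_smul_linkOrientation L hw hwU u hrel (g z)
  -- `linkOrientation (g z) = g_* ζ_z`
  have hlink : (L.linkOrientation hw).localClass (g z) =
      relativeSingularHomology.map ℤ ℤ g (LocalFamily.mapsTo_compl_pt hg z) (m + 1) (ζ.localClass z) := by
    haveI := localHomology.isIso_map_of_isOpenEmbedding_of_eq ℤ ℤ L.inclB L.isOpenEmbedding_inclB (g z) rfl (m + 1)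
    apply ((ModuleCat.mono_iff_injective (relativeSingularHomology.map ℤ ℤ L.inclB
      (LocalFamily.mapsTo_compl_pt L.isOpenEmbedding_inclB.injective (g z)) (m + 1))).1 inferInstance)
    rw [L.map_inclB_linkOrientation_localClass hw (g z), hζ z, ← ModuleCat.comp_apply,
      ← relativeSingularHomology.map_comp]
    rfl
  rw [hO, hlink, ← ModuleCat.comp_apply, ← relativeSingularHomology.map_comp]

end NullCobordism.Piece

section TransportLemmas

variable {k : ℕ} {S MU Y Z : Type} [TopologicalSpace S] [TopologicalSpace MU] [TopologicalSpace Y]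
  [TopologicalSpace Z] [T2Space Y] [T2Space Z] [ChartedSpace (EuclideanSpace ℝ (Fin k)) Y]
  [ChartedSpace (EuclideanSpace ℝ (Fin k)) Z]

omit [T2Space Z] [ChartedSpace (EuclideanSpace ℝ (Fin k)) Y] in
/-- **Pull-back of a twice-transported orientation, pushed forward to the source**:
`(e_U ∘ Ψ ∘ κ)_* (((ω.comap e_U).comap Ψ)|_κ)_z = ω_b` whenever `e_U (Ψ (κ z)) = b`. [folklore] -/
theorem map_pullback_comap_comap_localClass (om : HomologicalOrientation ℤ S k) (eU : MU ≃ₜ S) (Ψ : Y ≃ₜ MU)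
    (κ : C(Z, Y)) (hκ : IsOpenEmbedding κ) (z : Z) {b : S} (hb : eU (Ψ (κ z)) = b) :
    relativeSingularHomology.map ℤ ℤ (((eU : C(MU, S)).comp ((Ψ : Y ≃ₜ MU) : C(Y, MU))).comp κ)
      (Literature.AlgebraicTopology.SingularHomology.mapsTo_compl_singleton_of_injective
        ((eU.injective.comp Ψ.injective).comp hκ.injective) hb) k
        ((((om.comap eU).comap Ψ).pullback κ hκ).localClass z) = om.localClass b := by
  subst hb
  have e1 := ((om.comap eU).comap Ψ).map_pullback_localClass κ hκ z
  rw [HomologicalOrientation.comap_comap_localClass] at e1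
  have e2 := map_comap_localClass_of_eq om (Ψ.trans eU) (y := κ z) rfl
  have e3 : relativeSingularHomology.map ℤ ℤ (((eU : C(MU, S)).comp ((Ψ : Y ≃ₜ MU) : C(Y, MU))).comp κ)
      ((LocalFamily.mapsTo_compl_pt (j := ⇑((eU : C(MU, S)).comp ((Ψ : Y ≃ₜ MU) : C(Y, MU))))
        (eU.injective.comp Ψ.injective) (κ z)).comp (LocalFamily.mapsTo_compl_pt hκ.injective z)) k
        ((((om.comap eU).comap Ψ).pullback κ hκ).localClass z) = om.localClass (eU (Ψ (κ z))) := by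
    rw [relativeSingularHomology.map_comp ℤ ℤ κ _ (LocalFamily.mapsTo_compl_pt hκ.injective z)
      ((LocalFamily.mapsTo_compl_pt (j := ⇑((eU : C(MU, S)).comp ((Ψ : Y ≃ₜ MU) : C(Y, MU))))
          (eU.injective.comp Ψ.injective) (κ z))), ModuleCat.comp_apply, e1]
    exact e2
  exact e3

omit [T2Space Z] [ChartedSpace (EuclideanSpace ℝ (Fin k)) Y] in
/-- From a pull-back along `κ ∘ ι` to the pull-back along `κ`: `(Θ|_κ)_{ι z} = ι_* ((Θ|_{κ ∘ ι})_z)`.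
[folklore] -/
theorem pullback_localClass_eq_map_pullback_comp {X : Type} [TopologicalSpace X] [T2Space X]
    [ChartedSpace (EuclideanSpace ℝ (Fin k)) X] (Θ : HomologicalOrientation ℤ Y k)
    (κ : C(X, Y)) (hκ : IsOpenEmbedding κ) (ι : C(Z, X)) (hι : IsOpenEmbedding ι) (z : Z) :
    (Θ.pullback κ hκ).localClass (ι z) =
      relativeSingularHomology.map ℤ ℤ ι (LocalFamily.mapsTo_compl_pt hι.injective z) k
        ((Θ.pullback (κ.comp ι) (hκ.comp hι)).localClass z) := by
  haveI := localHomology.isIso_map_of_isOpenEmbedding_of_eq ℤ ℤ κ hκ (ι z) rfl k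
  apply ((ModuleCat.mono_iff_injective (relativeSingularHomology.map ℤ ℤ κ
    (LocalFamily.mapsTo_compl_pt hκ.injective (ι z)) k)).1 inferInstance)
  rw [Θ.map_pullback_localClass κ hκ (ι z), ← ModuleCat.comp_apply, ← relativeSingularHomology.map_comp]
  exact (Θ.map_pullback_localClass (κ.comp ι) (hκ.comp hι) z).symm

end TransportLemmas


/-! ### O6d. Small unfoldings for the split presentation -/

section SplitUnfold

variable {d : ℕ} (hd : d ≠ 0) {A A' B B' : Type}
  [TopologicalSpace A] [T2Space A] [ChartedSpace (EuclideanSpace ℝ (Fin d)) A] [IsManifold (𝓡 d) ∞ A]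
  [TopologicalSpace A'] [T2Space A'] [ChartedSpace (EuclideanSpace ℝ (Fin d)) A'] [IsManifold (𝓡 d) ∞ A']
  [TopologicalSpace B] [T2Space B] [ChartedSpace (EuclideanSpace ℝ (Fin d)) B] [IsManifold (𝓡 d) ∞ B]
  [TopologicalSpace B'] [T2Space B'] [ChartedSpace (EuclideanSpace ℝ (Fin d)) B'] [IsManifold (𝓡 d) ∞ B']
  (D : ConnectedSumData d A B)

omit [IsManifold (𝓡 d) ∞ A'] [T2Space B] [T2Space B'] [IsManifold (𝓡 d) ∞ B'] in
/-- A bottom point `inl a'` of `A' ⊔ A` lies in the first punctured piece. [folklore] -/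
theorem ConnectedSumData.inl_mem_puncture_sumInr_i₁ (a' : A') :
    (Sum.inl a' : A' ⊕ A) ∈ puncture (D.sumInr (A' := A') (B' := B')).i₁ :=
  mem_puncture.2 fun h => Sum.inl_ne_inr h

omit [T2Space A] [T2Space A'] [IsManifold (𝓡 d) ∞ A'] [IsManifold (𝓡 d) ∞ B'] in
/-- A bottom point `inl b'` of `B' ⊔ B` lies in the second punctured piece. [folklore] -/
theorem ConnectedSumData.inl_mem_puncture_sumInr_i₂ (b' : B') :
    (Sum.inl b' : B' ⊕ B) ∈ puncture (D.sumInr (A' := A') (B' := B')).i₂ :=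
  mem_puncture.2 fun h => Sum.inl_ne_inr h

omit [T2Space B] [T2Space B'] [IsManifold (𝓡 d) ∞ B'] in
/-- `splitA⁻¹ (inl a') = inl a'`. [folklore] -/
theorem ConnectedSumData.splitA_symm_inl (a' : A') :
    (D.splitA (B' := B')).symm ⟨Sum.inl a', D.inl_mem_puncture_sumInr_i₁ a'⟩ = Sum.inl a' := by
  have h : D.splitA (B' := B') (Sum.inl a') = ⟨Sum.inl a', D.inl_mem_puncture_sumInr_i₁ a'⟩ := Subtype.ext rfl
  rw [← h, Diffeomorph.symm_apply_apply]

omit [T2Space A] [T2Space A'] [IsManifold (𝓡 d) ∞ A'] in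
/-- `splitB⁻¹ (inl b') = inl b'`. [folklore] -/
theorem ConnectedSumData.splitB_symm_inl (b' : B') :
    (D.splitB (A' := A')).symm ⟨Sum.inl b', D.inl_mem_puncture_sumInr_i₂ b'⟩ = Sum.inl b' := by
  have h : D.splitB (A' := A') (Sum.inl b') = ⟨Sum.inl b', D.inl_mem_puncture_sumInr_i₂ b'⟩ := Subtype.ext rfl
  rw [← h, Diffeomorph.symm_apply_apply]

end SplitUnfold

namespace NullCobordism

variable {n : ℕ} {M : Type} [TopologicalSpace M] [ChartedSpace (EuclideanSpace ℝ (Fin (n + 1))) M]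
  [IsManifold (𝓡 (n + 1)) ∞ M] [CompactSpace M] [T2Space M]

omit [CompactSpace M] [T2Space M] in
/-- Half-ball orientations only depend on the disc as a function. [folklore] -/
theorem halfBallOrientation_congr (c : NullCobordism (n + 1) M) (κ : c.boundaryData.Collar)
    {i i' : EuclideanSpace ℝ (Fin (n + 1)) → M} (hi : Manifold.IsSmoothEmbedding (𝓡 (n + 1)) (𝓡 (n + 1)) ∞ i)
    (hi' : Manifold.IsSmoothEmbedding (𝓡 (n + 1)) (𝓡 (n + 1)) ∞ i') (h : i = i')
    {w : relativeSingularHomology ℤ ℤ c.W ((𝓡∂ (n + 1 + 1)).boundary c.W) (n + 1 + 1)}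
    (hw : IsRelFundamentalClass ℤ ((𝓡∂ (n + 1 + 1)).boundary c.W) w) :
    c.halfBallOrientation κ hi hw = c.halfBallOrientation κ hi' hw := by
  subst h; rfl

end NullCobordism

/-! ### O6e. The oriented merging theorem -/

section OrientedMerging

/-- `(1 : ℤˣ) • x = x`. [folklore] -/
private theorem units_one_zsmul {G : Type*} [AddCommGroup G] (x : G) : ((1 : ℤˣ) : ℤ) • x = x := by
  rw [Units.val_one, one_zsmul]

/-- **Oriented merging lemma: `(A ⊔ B, α ⊔ β)` is oriented-bordant to a connected closed oriented
manifold** (namely `A # B` with an orientation), for closed connected nonempty oriented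
`(A, α)`, `(B, β) : Type` of dimension `n + 1 ≥ 2`.  This is the hypothesis `hmerge` of
`isOrientedBordant_of_isEmpty_of_signature_eq_zero_of_connected` (Kirby 1989: classes of `Ω₄^SO`
have connected representatives, through `(M₁ ⊔ M₂) × I ∪ 1-handle`, i.e. the boundary connected
sum of the cylinders, Kervaire–Milnor 1963, §2 Lemma 2.2 with its orientation Addendum
"`bW = bW₁ # bW₂` as oriented manifolds").

Proof.  The cylinders `A × I`, `B × I` are oriented null-cobordisms of the doubles with relative
fundamental classes `w_S`, `w_T` inducing `α`, `β` on the bottom copies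
(`exists_isRelFundamentalClass_cylinderNull`).  Their boundary connected sum at discs of the top
copies (`NullCobordism.bcsSetupOf`) carries a glued relative fundamental class `w_U` matching
`w_S` exactly and `w_T` up to a sign `ε` (`BCSGluing.exists_isRelFundamentalClass`).  The sign is
read on the open unit half-ball (`halfBallOrientation_localClass_eq_smul`), and reflecting the
disc of `B` reverses it (`units_eq_neg_of_halfBall`), so for one of the two discs `ε = 1`.
Then the boundary orientation `∂w_U`, transported to `(A ⊔ B) ⊔ (A # B)` along the split
presentation (`BordismMerging`), restricts to `α` and `β` on the untouched bottom copies
(`boundaryOrientation_localClass_bpt_eq_smul_map`, orientations of the connected `A`, `B`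
agreeing at one point are equal), and Thom's dictionary (`IsOrientedBordant.of_sum_of_isEmpty`)
reads the oriented null-bordism of `((A ⊔ B) ⊔ C, (α ⊔ β) ⊔ Θ_C)` as `(α ⊔ β) ∼ −Θ_C`.
[cite: Kirby1989, Ch. VIII (with Cor. IX.2); KervaireMilnorAnnals1963, §2 Lemma 2.2 and Addendum] -/
theorem exists_isOrientedBordant_sum_connectedSpace {n : ℕ} (hn : 1 ≤ n) {A B : Type}
    [TopologicalSpace A] [T2Space A] [SecondCountableTopology A]
    [ChartedSpace (EuclideanSpace ℝ (Fin (n + 1))) A] [IsManifold (𝓡 (n + 1)) ∞ A] [CompactSpace A]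
    [ConnectedSpace A] [Nonempty A]
    [TopologicalSpace B] [T2Space B] [SecondCountableTopology B]
    [ChartedSpace (EuclideanSpace ℝ (Fin (n + 1))) B] [IsManifold (𝓡 (n + 1)) ∞ B] [CompactSpace B]
    [ConnectedSpace B] [Nonempty B]
    (α : HomologicalOrientation ℤ A (n + 1)) (β : HomologicalOrientation ℤ B (n + 1))
    (ξ : HomologicalOrientation ℤ (A ⊕ B) (n + 1))
    (hξ₁ : ∀ a, ξ.localClass (Sum.inl a) = relativeSingularHomology.map ℤ ℤ (sumInl A B)
      (mapsTo_inl_compl_singleton a) (n + 1) (α.localClass a))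
    (hξ₂ : ∀ b, ξ.localClass (Sum.inr b) = relativeSingularHomology.map ℤ ℤ (sumInr A B)
      (mapsTo_inr_compl_singleton b) (n + 1) (β.localClass b)) :
    ∃ (C : Type) (_ : TopologicalSpace C) (_ : T2Space C) (_ : SecondCountableTopology C)
      (_ : ChartedSpace (EuclideanSpace ℝ (Fin (n + 1))) C) (_ : IsManifold (𝓡 (n + 1)) ∞ C)
      (_ : CompactSpace C) (_ : ConnectedSpace C) (γ : HomologicalOrientation ℤ C (n + 1)),
      IsOrientedBordant (n + 1) ξ γ := by
  classical
  have hd : n + 1 ≠ 0 := Nat.succ_ne_zero n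
  -- the oriented cylinders over `A`, `B` (null-cobordisms of the doubles)
  obtain ⟨wS, hwS, hbotS⟩ := exists_isRelFundamentalClass_cylinderNull (n := n) α
  obtain ⟨wT, hwT, hbotT⟩ := exists_isRelFundamentalClass_cylinderNull (n := n) β
  -- shared collars
  obtain ⟨κS⟩ := BoundaryData.nonempty_collar_of_compactSpace n (cylinderNull n A).W (cylinderNull n A).boundaryData
  obtain ⟨κT⟩ := BoundaryData.nonempty_collar_of_compactSpace n (cylinderNull n B).W (cylinderNull n B).boundaryData
  -- discs of `A`, `B`; the second configuration reflects the disc of `B`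
  obtain ⟨D⟩ := nonempty_connectedSumData (n := n + 1) (M := A) (N := B)
  obtain ⟨e₂', he₂', ht₂', hse₂'⟩ := ConnectedSumData.exists_of_isSmoothEmbedding
    (NullCobordism.isSmoothEmbedding_comp_tailReflect D.isSmoothEmbedding_i₂)
  let D' : ConnectedSumData (n + 1) A B := ⟨D.e₁, e₂', D.mem_maximalAtlas₁, he₂', D.target₁, ht₂'⟩
  have hD'i₂ : D'.i₂ = D.i₂ ∘ tailReflect n := hse₂'
  -- the two boundary connected sums and their glued relative fundamental classes
  let Xof : ConnectedSumData (n + 1) A B → NullCobordism.BCSSetup n := fun Dx =>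
    NullCobordism.bcsSetupOf (cylinderNull n A) (cylinderNull n B) κS κT (Dx.sumInr (A' := A) (B' := B))
  haveI hcMU : ∀ Dx, CompactSpace (Xof Dx).MU := fun Dx =>
    inferInstanceAs (CompactSpace ((Dx.sumInr (A' := A) (B' := B)).Glued hd))
  haveI htMU : ∀ Dx, T2Space (Xof Dx).MU := fun Dx =>
    inferInstanceAs (T2Space ((Dx.sumInr (A' := A) (B' := B)).Glued hd))
  -- the statement we extract from a configuration: a glued relative fundamental class matching
  -- `w_S` and `w_T` EXACTLY (sign `+1` on both pieces)
  let Good : ConnectedSumData (n + 1) A B → Prop := fun Dx =>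
    ∃ (wU : relativeSingularHomology ℤ ℤ (Xof Dx).glued.W ((𝓡∂ (n + 1 + 1)).boundary (Xof Dx).glued.W) (n + 1 + 1))
      (hwU : IsRelFundamentalClass ℤ ((𝓡∂ (n + 1 + 1)).boundary (Xof Dx).glued.W) wU),
      (∀ (x : (Xof Dx).pieceS.A) (hx : ((x : (Xof Dx).pieceS.A) : (Xof Dx).cS.W) ∈ ((𝓡∂ (n + 1 + 1)).boundary (Xof Dx).cS.W)ᶜ),
        relativeSingularHomology.toLocal ℤ ℤ _ ⟨(Xof Dx).pieceS.j x, (Xof Dx).pieceS.j_mem_compl_boundary hx⟩ (n + 1 + 1) wU =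
          ((1 : ℤˣ) : ℤ) • relativeSingularHomology.map ℤ ℤ (Xof Dx).pieceS.j
            (LocalFamily.mapsTo_compl_pt (Xof Dx).pieceS.j_injective x) (n + 1 + 1) ((Xof Dx).pieceS.pieceClass wS x)) ∧
      (∀ (y : (Xof Dx).pieceT.A) (hy : ((y : (Xof Dx).pieceT.A) : (Xof Dx).cT.W) ∈ ((𝓡∂ (n + 1 + 1)).boundary (Xof Dx).cT.W)ᶜ),
        relativeSingularHomology.toLocal ℤ ℤ _ ⟨(Xof Dx).pieceT.j y, (Xof Dx).pieceT.j_mem_compl_boundary hy⟩ (n + 1 + 1) wU =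
          ((1 : ℤˣ) : ℤ) • relativeSingularHomology.map ℤ ℤ (Xof Dx).pieceT.j
            (LocalFamily.mapsTo_compl_pt (Xof Dx).pieceT.j_injective y) (n + 1 + 1) ((Xof Dx).pieceT.pieceClass wT y))
  have hconf : ∃ Dx, Good Dx := by
    haveI := hcMU D; haveI := htMU D; haveI := hcMU D'; haveI := htMU D'
    obtain ⟨ε₁, wU₁, hwU₁, hS₁, hT₁⟩ := (Xof D).gluing.exists_isRelFundamentalClass hwS hwT
    obtain ⟨ε₂, wU₂, hwU₂, hS₂, hT₂⟩ := (Xof D').gluing.exists_isRelFundamentalClass hwS hwT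
    -- the signs, read on the half-ball; reflecting the disc reverses the sign
    have hb₁ := (Xof D).halfBallOrientation_localClass_eq_smul hwS hwT ε₁ hS₁ hT₁
    have hb₂ := (Xof D').halfBallOrientation_localClass_eq_smul hwS hwT ε₂ hS₂ hT₂
    have hdisc : (D'.sumInr (A' := A) (B' := B)).i₂ = (D.sumInr (A' := A) (B' := B)).i₂ ∘ tailReflect n := by
      funext v
      change Sum.inr (D'.i₂ v) = Sum.inr (D.i₂ (tailReflect n v))
      rw [hD'i₂]
      rfl
    have hbT : (Xof D').cT.halfBallOrientation (Xof D').κT (Xof D').hiT hwT =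
        ((Xof D).cT.halfBallOrientation (Xof D).κT (Xof D).hiT hwT).comap (halfBallReflect n) := by
      have e1 : (Xof D').cT.halfBallOrientation (Xof D').κT (Xof D').hiT hwT =
          (cylinderNull n B).halfBallOrientation κT (NullCobordism.isSmoothEmbedding_comp_tailReflect (Xof D).hiT) hwT :=
        (cylinderNull n B).halfBallOrientation_congr κT (Xof D').hiT _ hdisc hwT
      rw [e1]
      ext v : 2
      exact (cylinderNull n B).halfBallOrientation_comp_tailReflect_localClass κT (Xof D).hiT hwT v
    have hflip : ε₂ = -ε₁ := units_eq_neg_of_halfBall hb₁ (fun v => by rw [← hbT]; exact hb₂ v)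
    rcases Int.units_eq_one_or ε₁ with h1 | h1
    · exact ⟨D, wU₁, hwU₁, fun x hx => (hS₁ x hx).trans (units_one_zsmul _).symm,
        fun y hy => h1 ▸ hT₁ y hy⟩
    · have h2 : ε₂ = 1 := by rw [hflip, h1, neg_neg]
      exact ⟨D', wU₂, hwU₂, fun x hx => (hS₂ x hx).trans (units_one_zsmul _).symm,
        fun y hy => h2 ▸ hT₂ y hy⟩
  obtain ⟨Dx, wU, hwU, hS, hT⟩ := hconf
  haveI := hcMU Dx; haveI := htMU Dx
  set X := Xof Dx with hX
  -- the split presentation `M_U = (A ⊔ A) # (B ⊔ B) ≅ (A ⊔ B) ⊔ (A # B)`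
  have hA' := (Dx.isSmoothEmbedding_fA hd (A' := A) (B' := B)).comp_diffeomorph (Dx.splitA (B' := B)).symm
  have hB' := (Dx.isSmoothEmbedding_fB hd (A' := A) (B' := B)).comp_diffeomorph (Dx.splitB (A' := A)).symm
  have hrA : range (Dx.fA hd (A' := A) (B' := B) ∘ (Dx.splitA (B' := B)).symm) = range (Dx.fA hd) :=
    (Dx.splitA (B' := B)).symm.surjective.range_comp _
  have hrB : range (Dx.fB hd (A' := A) (B' := B) ∘ (Dx.splitB (A' := A)).symm) = range (Dx.fB hd) :=
    (Dx.splitB (A' := A)).symm.surjective.range_comp _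
  obtain ⟨Φ, hΦA, hΦB⟩ := IsOpenGluing.exists_diffeomorph_comp_eq (IP := 𝓡 (n + 1)) (IP' := 𝓡 (n + 1))
    (P := (Dx.sumInr (A' := A) (B' := B)).Glued hd) (P' := (A ⊕ B) ⊕ Dx.Glued hd)
    ((Dx.sumInr (A' := A) (B' := B)).glueData hd).isSmoothEmbedding_inl
    ((Dx.sumInr (A' := A) (B' := B)).glueData hd).isOpen_range_inl
    ((Dx.sumInr (A' := A) (B' := B)).glueData hd).isSmoothEmbedding_inr
    ((Dx.sumInr (A' := A) (B' := B)).glueData hd).isOpen_range_inr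
    ((Dx.sumInr (A' := A) (B' := B)).glueData hd).range_inl_union_range_inr
    (fun a b => (Dx.sumInr (A' := A) (B' := B)).inl_eq_inr_iff_connectedSumRel hd a b)
    hA' (hrA ▸ Dx.isOpen_range_fA hd) hB' (hrB ▸ Dx.isOpen_range_fB hd)
    (by rw [hrA, hrB]; exact Dx.range_fA_union_range_fB hd) (fun a b => Dx.fA_splitA_symm_eq_iff hd a b)
  -- the oriented null-bordism of the glued boundary, transported to `(A ⊔ B) ⊔ C`
  letI : ChartedSpace (EuclideanSpace ℝ (Fin (n + 1))) PEmpty.{1} := ChartedSpace.empty _ _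
  let εE : HomologicalOrientation ℤ PEmpty.{1} (n + 1) :=
    { localClass := fun e => isEmptyElim e
      isGenerator := fun e => isEmptyElim e
      locallyConsistent := fun e => isEmptyElim e }
  set θU := boundaryOrientation ℤ n.succ_ne_zero hwU with hθU
  set eU := X.glued.bdryHomeomorph with heU
  have hbd : IsOrientedBordant (n + 1) (θU.comap eU) εE :=
    X.glued.isOrientedBordant_boundaryOrientation_comap hwU εE
  set Θ' : HomologicalOrientation ℤ ((A ⊕ B) ⊕ Dx.Glued hd) (n + 1) := (θU.comap eU).comap Φ.symm.toHomeomorph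
    with hΘ'
  have hbd' : IsOrientedBordant (n + 1) Θ' εE := hbd.of_diffeomorph_left Φ.symm
  -- `Θ' = Θ_AB ⊔ Θ_C`
  set ΘAB := Θ'.pullback (sumInl (A ⊕ B) (Dx.Glued hd)) IsOpenEmbedding.inl with hΘAB
  set ΘC := Θ'.pullback (sumInr (A ⊕ B) (Dx.Glued hd)) IsOpenEmbedding.inr with hΘC
  have hdict : IsOrientedBordant (n + 1) ΘAB (-ΘC) :=
    IsOrientedBordant.of_sum_of_isEmpty (μ := ΘAB) (ν := -ΘC) (ξ := Θ')
      (fun x => localClass_inl_eq_map_pullback Θ' x)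
      (fun y => by rw [neg_neg]; exact localClass_inr_eq_map_pullback Θ' y) hbd'
  -- it remains to see `Θ_AB = α ⊔ β`
  suffices hAB : ΘAB = ξ by
    haveI : ConnectedSpace (Dx.Glued hd) :=
      IsConnectedSum.connectedSpace_holds (by rw [finrank_euclideanSpace_fin]; omega) (Dx.isConnectedSum_glued hd)
    exact ⟨Dx.Glued hd, inferInstance, inferInstance, inferInstance, inferInstance, inferInstance,
      inferInstance, inferInstance, -ΘC, hAB ▸ hdict⟩
  set ΘA := Θ'.pullback ((sumInl (A ⊕ B) (Dx.Glued hd)).comp (sumInl A B))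
    (IsOpenEmbedding.inl.comp IsOpenEmbedding.inl) with hΘA
  set ΘB := Θ'.pullback ((sumInl (A ⊕ B) (Dx.Glued hd)).comp (sumInr A B))
    (IsOpenEmbedding.inl.comp IsOpenEmbedding.inr) with hΘB
  -- the bottom copies inside the links
  let gA : C(A, ↥(puncture (Dx.sumInr (A' := A) (B' := B)).i₁)) :=
    ⟨fun a => ⟨Sum.inl a, Dx.inl_mem_puncture_sumInr_i₁ (A' := A) (B' := B) a⟩, (continuous_inl.subtype_mk _)⟩
  have hgA : Injective gA := fun a a' h => Sum.inl_injective (congrArg Subtype.val h)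
  let gB : C(B, ↥(puncture (Dx.sumInr (A' := A) (B' := B)).i₂)) :=
    ⟨fun b => ⟨Sum.inl b, Dx.inl_mem_puncture_sumInr_i₂ (A' := A) (B' := B) b⟩, (continuous_inl.subtype_mk _)⟩
  have hgB : Injective gB := fun b b' h => Sum.inl_injective (congrArg Subtype.val h)
  -- where `Φ⁻¹` sends the bottom copies
  have hΦsA : ∀ a, Φ.symm (Sum.inl (Sum.inl a)) = X.jA (gA a) := fun a => by
    have h := hΦA (gA a)
    have h' : (Dx.fA hd (A' := A) (B' := B) ∘ (Dx.splitA (B' := B)).symm) (gA a) = Sum.inl (Sum.inl a) := by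
      have h2 : (Dx.splitA (B' := B)).symm (gA a) = Sum.inl a := Dx.splitA_symm_inl a
      change Dx.fA hd ((Dx.splitA (B' := B)).symm (gA a)) = _
      rw [h2]; rfl
    exact (congrArg Φ.symm (h.trans h').symm).trans (Φ.symm_apply_apply _)
  have hΦsB : ∀ b, Φ.symm (Sum.inl (Sum.inr b)) = X.jB (gB b) := fun b => by
    have h := hΦB (gB b)
    have h' : (Dx.fB hd (A' := A) (B' := B) ∘ (Dx.splitB (A' := A)).symm) (gB b) = Sum.inl (Sum.inr b) := by
      have h2 : (Dx.splitB (A' := A)).symm (gB b) = Sum.inl b := Dx.splitB_symm_inl b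
      change Dx.fB hd ((Dx.splitB (A' := A)).symm (gB b)) = _
      rw [h2]; rfl
    exact (congrArg Φ.symm (h.trans h').symm).trans (Φ.symm_apply_apply _)
  -- (A) `Θ_A = α`: compare at one point, inside `H(∂W_U | ·)`
  have hA : ΘA = α := by
    obtain ⟨a₀⟩ := (inferInstance : Nonempty A)
    refine HomologicalOrientation.ext_of_connected_holds ℤ (X := A) ΘA α a₀ ?_
    -- the boundary-orientation side
    have hζ : ∀ a, (boundaryOrientation ℤ n.succ_ne_zero hwS).localClass (X.linkS.inclB (gA a)) =
        relativeSingularHomology.map ℤ ℤ (X.linkS.inclB.comp gA)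
          (LocalFamily.mapsTo_compl_pt (X.linkS.isOpenEmbedding_inclB.injective.comp hgA) a) (n + 1)
          (α.localClass a) := by
      intro a
      exact hbotS a
    have hdag := X.pieceS.boundaryOrientation_localClass_bpt_eq_smul_map X.linkS hwS hwU 1 hS gA hgA α hζ a₀
    -- the transported side
    have hpt : eU (Φ.symm.toHomeomorph (((sumInl (A ⊕ B) (Dx.Glued hd)).comp (sumInl A B)) a₀)) =
        X.linkS.bpt (gA a₀) := by
      rw [NullCobordism.Piece.BdryLink.bpt_eq]
      change eU (Φ.symm (Sum.inl (Sum.inl a₀))) = X.glued.bdryHomeomorph (X.jA (gA a₀))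
      rw [hΦsA]
    have hddag := map_pullback_comap_comap_localClass θU eU Φ.symm.toHomeomorph
      ((sumInl (A ⊕ B) (Dx.Glued hd)).comp (sumInl A B)) (IsOpenEmbedding.inl.comp IsOpenEmbedding.inl) a₀ hpt
    -- the two maps `A → ∂W_U` agree
    have hmaps : (((eU : C(X.MU, ↥((𝓡∂ (n + 1 + 1)).boundary X.glued.W))).comp
        ((Φ.symm.toHomeomorph : ((A ⊕ B) ⊕ Dx.Glued hd) ≃ₜ (Dx.sumInr (A' := A) (B' := B)).Glued hd) :
        C((A ⊕ B) ⊕ Dx.Glued hd, (Dx.sumInr (A' := A) (B' := B)).Glued hd))).comp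
          ((sumInl (A ⊕ B) (Dx.Glued hd)).comp (sumInl A B))) =
        (((eU : C(X.MU, ↥((𝓡∂ (n + 1 + 1)).boundary X.glued.W))).comp X.linkS.jC).comp gA) := by
      ext a : 2
      change (eU (Φ.symm (Sum.inl (Sum.inl a))) : X.glued.W) = eU (X.jA (gA a))
      rw [hΦsA]
    rw [Units.val_one, one_zsmul] at hdag
    have hO : IsOpenEmbedding (((eU : C(X.MU, ↥((𝓡∂ (n + 1 + 1)).boundary X.glued.W))).comp X.linkS.jC).comp gA) := by
      rw [← hmaps]
      exact (eU.isOpenEmbedding.comp Φ.symm.toHomeomorph.isOpenEmbedding).comp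
        (IsOpenEmbedding.inl.comp IsOpenEmbedding.inl)
    have hFpt : (((eU : C(X.MU, ↥((𝓡∂ (n + 1 + 1)).boundary X.glued.W))).comp X.linkS.jC).comp gA) a₀ =
        X.linkS.bpt (gA a₀) := (NullCobordism.Piece.BdryLink.bpt_eq X.linkS (gA a₀)).symm
    haveI := localHomology.isIso_map_of_isOpenEmbedding_of_eq ℤ ℤ _ hO a₀ hFpt (n + 1)
    apply ((ModuleCat.mono_iff_injective (relativeSingularHomology.map ℤ ℤ
      (((eU : C(X.MU, ↥((𝓡∂ (n + 1 + 1)).boundary X.glued.W))).comp X.linkS.jC).comp gA)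
      (Literature.AlgebraicTopology.SingularHomology.mapsTo_compl_singleton_of_injective hO.injective hFpt)
      (n + 1))).1 inferInstance)
    have hcongr := congrArg (fun f : (localHomology ℤ ℤ A a₀ (n + 1) ⟶ _) => f (ΘA.localClass a₀))
      (relativeSingularHomology.map_congr_left (R := ℤ) (M := ℤ) hmaps
        (Literature.AlgebraicTopology.SingularHomology.mapsTo_compl_singleton_of_injective
          ((eU.injective.comp Φ.symm.toHomeomorph.injective).comp
            (IsOpenEmbedding.inl.comp IsOpenEmbedding.inl).injective) hpt)
        (Literature.AlgebraicTopology.SingularHomology.mapsTo_compl_singleton_of_injective hO.injective hFpt)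
        (n + 1))
    exact hcongr.symm.trans (hddag.trans hdag)
  -- (B) `Θ_B = β`
  have hB : ΘB = β := by
    obtain ⟨b₀⟩ := (inferInstance : Nonempty B)
    refine HomologicalOrientation.ext_of_connected_holds ℤ (X := B) ΘB β b₀ ?_
    have hζ : ∀ b, (boundaryOrientation ℤ n.succ_ne_zero hwT).localClass (X.linkT.inclB (gB b)) =
        relativeSingularHomology.map ℤ ℤ (X.linkT.inclB.comp gB)
          (LocalFamily.mapsTo_compl_pt (X.linkT.isOpenEmbedding_inclB.injective.comp hgB) b) (n + 1)
          (β.localClass b) := by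
      intro b
      exact hbotT b
    have hdag := X.pieceT.boundaryOrientation_localClass_bpt_eq_smul_map X.linkT hwT hwU 1 hT gB hgB β hζ b₀
    have hpt : eU (Φ.symm.toHomeomorph (((sumInl (A ⊕ B) (Dx.Glued hd)).comp (sumInr A B)) b₀)) =
        X.linkT.bpt (gB b₀) := by
      rw [NullCobordism.Piece.BdryLink.bpt_eq]
      change eU (Φ.symm (Sum.inl (Sum.inr b₀))) = X.glued.bdryHomeomorph (X.jB (gB b₀))
      rw [hΦsB]
    have hddag := map_pullback_comap_comap_localClass θU eU Φ.symm.toHomeomorph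
      ((sumInl (A ⊕ B) (Dx.Glued hd)).comp (sumInr A B)) (IsOpenEmbedding.inl.comp IsOpenEmbedding.inr) b₀ hpt
    have hmaps : (((eU : C(X.MU, ↥((𝓡∂ (n + 1 + 1)).boundary X.glued.W))).comp
        ((Φ.symm.toHomeomorph : ((A ⊕ B) ⊕ Dx.Glued hd) ≃ₜ (Dx.sumInr (A' := A) (B' := B)).Glued hd) :
        C((A ⊕ B) ⊕ Dx.Glued hd, (Dx.sumInr (A' := A) (B' := B)).Glued hd))).comp
          ((sumInl (A ⊕ B) (Dx.Glued hd)).comp (sumInr A B))) =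
        (((eU : C(X.MU, ↥((𝓡∂ (n + 1 + 1)).boundary X.glued.W))).comp X.linkT.jC).comp gB) := by
      ext b : 2
      change (eU (Φ.symm (Sum.inl (Sum.inr b))) : X.glued.W) = eU (X.jB (gB b))
      rw [hΦsB]
    rw [Units.val_one, one_zsmul] at hdag
    have hO : IsOpenEmbedding (((eU : C(X.MU, ↥((𝓡∂ (n + 1 + 1)).boundary X.glued.W))).comp X.linkT.jC).comp gB) := by
      rw [← hmaps]
      exact (eU.isOpenEmbedding.comp Φ.symm.toHomeomorph.isOpenEmbedding).comp
        (IsOpenEmbedding.inl.comp IsOpenEmbedding.inr)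
    have hFpt : (((eU : C(X.MU, ↥((𝓡∂ (n + 1 + 1)).boundary X.glued.W))).comp X.linkT.jC).comp gB) b₀ =
        X.linkT.bpt (gB b₀) := (NullCobordism.Piece.BdryLink.bpt_eq X.linkT (gB b₀)).symm
    haveI := localHomology.isIso_map_of_isOpenEmbedding_of_eq ℤ ℤ _ hO b₀ hFpt (n + 1)
    apply ((ModuleCat.mono_iff_injective (relativeSingularHomology.map ℤ ℤ
      (((eU : C(X.MU, ↥((𝓡∂ (n + 1 + 1)).boundary X.glued.W))).comp X.linkT.jC).comp gB)
      (Literature.AlgebraicTopology.SingularHomology.mapsTo_compl_singleton_of_injective hO.injective hFpt)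
      (n + 1))).1 inferInstance)
    have hcongr := congrArg (fun f : (localHomology ℤ ℤ B b₀ (n + 1) ⟶ _) => f (ΘB.localClass b₀))
      (relativeSingularHomology.map_congr_left (R := ℤ) (M := ℤ) hmaps
        (Literature.AlgebraicTopology.SingularHomology.mapsTo_compl_singleton_of_injective
          ((eU.injective.comp Φ.symm.toHomeomorph.injective).comp
            (IsOpenEmbedding.inl.comp IsOpenEmbedding.inr).injective) hpt)
        (Literature.AlgebraicTopology.SingularHomology.mapsTo_compl_singleton_of_injective hO.injective hFpt)
        (n + 1))
    exact hcongr.symm.trans (hddag.trans hdag)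
  -- conclude `Θ_AB = ξ`
  ext p : 2
  rcases p with a | b
  · have h := pullback_localClass_eq_map_pullback_comp Θ' (sumInl (A ⊕ B) (Dx.Glued hd)) IsOpenEmbedding.inl
      (sumInl A B) IsOpenEmbedding.inl a
    change ΘAB.localClass (Sum.inl a) = relativeSingularHomology.map ℤ ℤ (sumInl A B) _ (n + 1) (ΘA.localClass a)
      at h
    rw [hA] at h
    rw [hξ₁ a]
    exact h
  · have h := pullback_localClass_eq_map_pullback_comp Θ' (sumInl (A ⊕ B) (Dx.Glued hd)) IsOpenEmbedding.inl
      (sumInr A B) IsOpenEmbedding.inr b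
    change ΘAB.localClass (Sum.inr b) = relativeSingularHomology.map ℤ ℤ (sumInr A B) _ (n + 1) (ΘB.localClass b)
      at h
    rw [hB] at h
    rw [hξ₂ b]
    exact h

end OrientedMerging


/-! ### Kirby's Cor. IX.2 reduced to connected manifolds -/

section Reduction

/-- **Kirby's Cor. IX.2 in every universe follows from its case of CONNECTED closed oriented
`4`-manifolds `M : Type`.**  The reduction `isOrientedBordant_of_isEmpty_of_signature_eq_zero_of_connected`
(`BordismFourComponents.lean`: split off components, connected representatives, bordism invariance
of the signature, reduction to `Type`) fed with the oriented merging lemma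
`exists_isOrientedBordant_sum_connectedSpace` (this file) in dimension `3 + 1`.  What remains —
the hypothesis `hconn` — is exactly Kirby 1989, VIII Thm 1(A) with IX Thm 1 (a closed smooth
connected oriented `4`-manifold of signature zero bounds), the non-formal core.
[cite: Kirby1989, Cor. IX.2 with VIII Thm 1(A) and IX Thm 1] -/
theorem isOrientedBordant_of_isEmpty_of_signature_eq_zero_of_connected'
    (hconn : ∀ (M N : Type) [TopologicalSpace M] [T2Space M] [SecondCountableTopology M]
      [ChartedSpace (EuclideanSpace ℝ (Fin 4)) M] [CompactSpace M] [IsManifold (𝓡 4) ∞ M]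
      [ConnectedSpace M]
      [TopologicalSpace N] [T2Space N] [SecondCountableTopology N]
      [ChartedSpace (EuclideanSpace ℝ (Fin 4)) N] [CompactSpace N] [IsManifold (𝓡 4) ∞ N] [IsEmpty N]
      (μ : HomologicalOrientation ℤ M 4) (ν : HomologicalOrientation ℤ N 4),
      μ.signature = 0 → IsOrientedBordant 4 μ ν) :
    isOrientedBordant_of_isEmpty_of_signature_eq_zero.{u} :=
  isOrientedBordant_of_isEmpty_of_signature_eq_zero_of_connected
    (fun A B _ _ _ _ _ _ _ _ _ _ _ _ _ _ α β ξ h₁ h₂ =>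
      exists_isOrientedBordant_sum_connectedSpace (n := 3) (by norm_num) α β ξ h₁ h₂)
    hconn

end Reduction

end Literature.Topology.FourManifolds
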